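import Literature.NumberTheory.LFunctions.NicolasHCZeroSum
import Literature.NumberTheory.LFunctions.NicolasLiThetaLimsupRH
import HarnessLib

/-!
# RH-CONDITIONAL (with an RH-FREE identity) · Nicolas 2022, Prop. 2.12 (2.53): under RH, `A(x) − R(x)` lies in a band of width `O(√x/log³ x)` around `8√x/log³ x` — the bridge between `A(x) = li(θ(x)) − π(x)` and the zero sum `R` of the highly-composite-numbers criterion; nothing here bears on the truth of RH

Literature-typing tranche `rh-lit-broughan-1` (Broughan, *Equivalents of the Riemann Hypothesis*
vol. 3, CUP 2023, ch. 2; PRIMARY: J.-L. Nicolas, *Highly composite numbers and the Riemann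
hypothesis*, Ramanujan J. 57 (2022) 507–550, preprint `hcnHR.pdf`, §2.5 (2.41)–(2.53), Prop. 2.12,
and §4.4–4.5). Everything here is PROVED (theorems only; no named facts).

Nicolas's Theorem 1.1 compares `log d(n)/log 2` with `F(log n) − R(log n)`,
`R(t) = (2√t + S(t))/log² t`, `S(t) = ∑_ρ t^ρ/ρ²` (tree: `Nicolas2022.R`, `Nicolas2022.S`). At a
superior highly composite number `N` with largest prime `ξ`, `log d(N)/log 2 − F(log N)` is
`−A(ξ) + (lower order)`, `A(x) = li(θ(x)) − π(x)` (tree: `liThetaSubPi`), so the theorem rests on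
comparing `A` with `R`. Prop. 2.12 (2.53) of the paper (from Nicolas 2017) is: under RH, for
`x ≥ 10⁸`, `R(x) + 5.12 √x/log³ x ≤ A(x) ≤ R(x) + 25.3 √x/log³ x`.

* RH-FREE. `Nicolas2022.robinD_eq_primeIntegral` — Robin's `D(x)` (tree: `RobinLiTheta.robinD`,
  `D′ = (t − ψ(t))/(t log² t)`) integrated by parts against Nicolas's `I(t) = ∫₁^t (1 − ψ(u)/u) du`
  (`Nicolas2022.primeIntegral`, `NicolasHCZeroSum.lean`):
  `D(x) = D(x₁) + I(x)/log² x − I(x₁)/log² x₁ + 2∫_{x₁}^x I(t) dt/(t log³ t)`.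
* RH-FREE. `Nicolas2022.liThetaSubPi_sub_R_eq` — the exact decomposition
  `A(x) − R(x) = J(x₁;x) + (P(x) − 2√x/log² x) − gap(x) + c(x₁) + (log(2π) log x − c₀ − E₁(x))/log² x`
  with `J(x₁;x) = 2∫_{x₁}^x I(t) dt/(t log³ t)`, `P` the prime-power part of `A` (tree:
  `LiThetaRH.posPart`, `= ∑_{k≥2} B(x^{1/k})/k`, `B(y) = π(y) − θ(y)/log y`), `gap ≥ 0` the
  concavity gap of `li` between `x` and `θ(x)`, and `c₀, E₁` from Lemma 2.5
  (`Nicolas2022.re_S_eq`). In words: **`A` and `R` agree to leading order unconditionally**; their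
  difference is the smoothed prime integral `J`, the prime-power term `P − 2√x/log² x ≈ 8√x/log³ x`,
  and the one-signed quadratic `gap`.
* RH-CONDITIONAL. `Nicolas2022.abs_jInt_le_of_RH` (`|J| ≤ (4τ + ε)√x/log³ x` eventually, from
  `|I(t)| ≤ τ√t + O(log t)`), `Nicolas2022.posPart_second_order_of_RH`
  (`P(x) = 2√x/log² x + 8√x/log³ x + o(√x/log³ x)`), and the assembled **Prop. 2.12 (2.53) in
  asymptotic form**: `Nicolas2022.prop_2_12_of_RH` — under RH, for every `ε > 0`, eventually
  `|A(x) − R(x) − 8√x/log³ x| ≤ (4τ + ε) √x/log³ x` (`τ = ∑ 1/|ρ|² = nicolasBeta = 0.046…`; the printed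
  band `[5.12, 25.3]` and the sharper `[7.99, 8.01]` of (4.22) use the finer Lemma 2.7; ours is
  `[8 − 0.19, 8 + 0.19]`).
* RH-FREE (§6). `Nicolas2022.twoLevel` — the two-level numbers `N(ξ) = ξ# · (ξ^{β₂})#` (the first
  two levels of a superior highly composite number), with `log N(ξ) = θ(ξ) + θ(ξ^{β₂})`
  (`Nicolas2022.log_twoLevel`, (3.33)) and `log d(N(ξ))/log 2 = π(ξ) + β₂ π(ξ^{β₂})`
  (`Nicolas2022.log2d_twoLevel`, (3.36)).
* RH-CONDITIONAL (§7–§8). `Nicolas2022.abs_R_sub_R_le_of_RH` (`R` is slowly varying: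
  `|R(ξ) − R(L)| ≤ C(|ξ − L|/√ξ + 1)` for `L ∈ [3ξ/4, 3ξ/2]`), `Nicolas2022.li_levels_le_of_RH`
  (the `li`-terms of `F` at two levels cost `≤ √ξ/log³ ξ`), and the assembled
  **`Nicolas2022.ineq19_twoLevel_eventually_of_RH`**: under RH, inequality (1.9) holds at `N(ξ)`
  for all large `ξ` (`F(L) − R(L) − log d(N)/log 2 ≤ (9.2 + 3)√ξ/log³ ξ ≤ 25.3 √L/log³ L`,
  `L = log N(ξ)`). Hence **`Nicolas2022.Nicolas2022_thm_1_1_iii_of_RH : RiemannHypothesis →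
  Nicolas2022_thm_1_1_iii`** — the RH half of the tree fact Thm. 1.1 (iii) is a theorem.

Literature note (for the referees of row V3-2): the printed proof of Thm. 1.1 (ii) (§4.4) and of the
`¬RH` case of (iii) (§4.5, (4.23)–(4.24)) chooses `ξ` along a sequence with `A(ξ) ≤ −ξ^ω·(large)`
(Robin's `Ω`-theorem) and concludes against (1.8) `log d(N)/log 2 ≤ F(L) − R(L) − …` without bounding
`−R(L)`; by `liThetaSubPi_sub_R_eq` the terms `−A(ξ)` and `+R(L)` cancel to leading order, so that
sequence does not by itself contradict (1.8). The tree keeps `Nicolas2022_thm_1_1_ii/iii` as named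
facts (cited as printed); the RH direction is unaffected (see `Nicolas2022_thm_1_1_iii_of_RH` below,
and `Nicolas2022_thm_1_1_i`).

## References

* J.-L. Nicolas, *Highly composite numbers and the Riemann hypothesis*, Ramanujan J. 57 (2022)
  507–550: (1.3)–(1.6), Lemma 2.5 (2.19), §2.5 (2.41)–(2.53), Prop. 2.12, §4.4–4.5.
  [Nicolas2022HC]
* J.-L. Nicolas, *Estimates of `li(θ(x)) − π(x)` and the Riemann hypothesis*, Springer PROMS 221
  (2017), Prop. 3.3, Prop. 3.5, Lemma 3.6 (the source of (2.46)–(2.49)). [Nicolas2017]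
* G. Robin, *Sur la différence `Li(θ(x)) − π(x)`*, Ann. Fac. Sci. Toulouse (5) 6 (1984), §4 (13),
  (15). [Robin1984Toulouse]
* K. Broughan, *Equivalents of the Riemann Hypothesis* vol. 3, CUP 2023, ch. 2 (secondary locator,
  not held). [Broughan2023Further]
-/

noncomputable section

open Real Filter Set Topology MeasureTheory intervalIntegral Asymptotics
open scoped Chebyshev

namespace Literature.NumberTheory.LFunctions

namespace Nicolas2022

open RobinLiTheta LiThetaRH LiThetaLimsup NicolasJExplicit NicolasJ

/-! ### §1. `D` through `I` (RH-free integration by parts) -/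

/-- Nicolas's smoothed prime integral `J(x₁; x) = 2∫_{x₁}^x I(t) dt/(t log³ t)`,
`I(t) = ∫₁^t (1 − ψ(u)/u) du`. [cite: Nicolas2022HC, §2.5 (2.42) and Lemma 2.5 (the `A₁ − S/log²` term)] -/
def jInt (x₁ x : ℝ) : ℝ := 2 * ∫ t in x₁..x, primeIntegral t / (t * Real.log t ^ 3)

/-- The weight `1/log² t` has derivative `−2/(t log³ t)` for `t > 1`. [folklore] -/
private theorem hasDerivAt_inv_log_sq {t : ℝ} (ht : 1 < t) :
    HasDerivAt (fun u : ℝ ↦ (Real.log u ^ 2)⁻¹) (-2 / (t * Real.log t ^ 3)) t := by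
  have ht0 : t ≠ 0 := by linarith
  have hl : Real.log t ≠ 0 := (Real.log_pos ht).ne'
  have h1 : HasDerivAt (fun u : ℝ ↦ Real.log u ^ 2) (((2 : ℕ) : ℝ) * Real.log t ^ (2 - 1) * t⁻¹) t :=
    (Real.hasDerivAt_log ht0).pow 2
  have h2 := h1.inv (pow_ne_zero 2 hl)
  refine h2.congr_deriv ?_
  have e : ((2 : ℕ) : ℝ) * Real.log t ^ (2 - 1) * t⁻¹ = 2 * Real.log t / t := by
    norm_num; rw [div_eq_mul_inv]
  rw [e]
  field_simp

/-- **`D(x) = D(x₁) + I(x)/log² x − I(x₁)/log² x₁ + J(x₁; x)`** for `2 ≤ x₁ ≤ x` (RH-free: Robin's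
`D′ = (t − ψ(t))/(t log² t) = I′(t)/log² t`, integrated by parts).
[cite: Nicolas2022HC, Lemma 2.5 with §2.5 (2.42); Robin1984Toulouse, §4 (15)] -/
theorem robinD_eq_primeIntegral {x₁ x : ℝ} (hx₁ : 2 ≤ x₁) (hx : x₁ ≤ x) :
    robinD x = robinD x₁ + primeIntegral x / Real.log x ^ 2 - primeIntegral x₁ / Real.log x₁ ^ 2 +
      jInt x₁ x := by
  -- integration by parts `∫ (u' v + u v') = u v |`
  have hu : ContinuousOn primeIntegral (Set.uIcc x₁ x) := by
    rw [Set.uIcc_of_le hx]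
    exact continuousOn_primeIntegral.mono fun t ht ↦ (by linarith [ht.1] : (1 : ℝ) ≤ t)
  have hv : ContinuousOn (fun u : ℝ ↦ (Real.log u ^ 2)⁻¹) (Set.uIcc x₁ x) := by
    rw [Set.uIcc_of_le hx]
    refine ContinuousOn.inv₀ ((Real.continuousOn_log.mono fun t ht ↦ ?_).pow 2) fun t ht ↦ ?_
    · simp only [mem_compl_iff, mem_singleton_iff]; linarith [ht.1]
    · exact pow_ne_zero 2 (Real.log_pos (by linarith [ht.1])).ne'
  have huu' : ∀ t ∈ Ioo (min x₁ x) (max x₁ x),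
      HasDerivWithinAt primeIntegral (1 - ψ t / t) (Ioi t) t := by
    intro t ht
    rw [min_eq_left hx] at ht
    exact hasDerivWithinAt_primeIntegral (by linarith [ht.1])
  have hvv' : ∀ t ∈ Ioo (min x₁ x) (max x₁ x),
      HasDerivWithinAt (fun u : ℝ ↦ (Real.log u ^ 2)⁻¹) (-2 / (t * Real.log t ^ 3)) (Ioi t) t := by
    intro t ht
    rw [min_eq_left hx] at ht
    exact (hasDerivAt_inv_log_sq (by linarith [ht.1])).hasDerivWithinAt
  have hu' : IntervalIntegrable (fun t : ℝ ↦ 1 - ψ t / t) volume x₁ x :=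
    intervalIntegrable_one_sub_psi_div (by linarith) hx
  have hv'c : ContinuousOn (fun t : ℝ ↦ -2 / (t * Real.log t ^ 3)) (Icc x₁ x) := by
    refine continuousOn_const.div (continuousOn_id.mul ((Real.continuousOn_log.mono fun t ht ↦ ?_).pow 3))
      fun t ht ↦ ?_
    · simp only [mem_compl_iff, mem_singleton_iff]; linarith [ht.1]
    · exact mul_ne_zero (by linarith [ht.1]) (pow_ne_zero 3 (Real.log_pos (by linarith [ht.1])).ne')
  have hv' : IntervalIntegrable (fun t : ℝ ↦ -2 / (t * Real.log t ^ 3)) volume x₁ x :=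
    hv'c.intervalIntegrable_of_Icc hx
  have hparts := intervalIntegral.integral_deriv_mul_eq_sub_of_hasDeriv_right hu hv huu' hvv' hu' hv'
  -- split the integral
  have hi1 : IntervalIntegrable (fun t : ℝ ↦ (1 - ψ t / t) * (Real.log t ^ 2)⁻¹) volume x₁ x :=
    hu'.mul_continuousOn hv
  have hi2 : IntervalIntegrable (fun t : ℝ ↦ primeIntegral t * (-2 / (t * Real.log t ^ 3))) volume x₁ x := by
    rw [Set.uIcc_of_le hx] at hu
    exact (hu.mul hv'c).intervalIntegrable_of_Icc hx
  rw [intervalIntegral.integral_add hi1 hi2] at hparts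
  -- the first integral is `∫ dDeriv = D(x) − D(x₁)`
  have hD : ∫ t in x₁..x, (1 - ψ t / t) * (Real.log t ^ 2)⁻¹ = robinD x - robinD x₁ := by
    rw [← integral_dDeriv_eq hx₁ hx]
    refine intervalIntegral.integral_congr fun t ht ↦ ?_
    rw [Set.uIcc_of_le hx] at ht
    have ht0 : t ≠ 0 := by linarith [ht.1]
    show (1 - ψ t / t) * (Real.log t ^ 2)⁻¹ = dDeriv t
    rw [dDeriv]
    field_simp
  -- the second is `−J`
  have hJ : ∫ t in x₁..x, primeIntegral t * (-2 / (t * Real.log t ^ 3)) = -jInt x₁ x := by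
    rw [jInt, ← intervalIntegral.integral_const_mul, ← intervalIntegral.integral_neg]
    refine intervalIntegral.integral_congr fun t _ ↦ ?_
    show primeIntegral t * (-2 / (t * Real.log t ^ 3)) = -(2 * (primeIntegral t / (t * Real.log t ^ 3)))
    ring
  rw [hD, hJ] at hparts
  have e1 : primeIntegral x * (Real.log x ^ 2)⁻¹ = primeIntegral x / Real.log x ^ 2 := by
    rw [div_eq_mul_inv]
  have e2 : primeIntegral x₁ * (Real.log x₁ ^ 2)⁻¹ = primeIntegral x₁ / Real.log x₁ ^ 2 := by
    rw [div_eq_mul_inv]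
  rw [e1, e2] at hparts
  linarith

/-! ### §2. The RH-free decomposition of `A − R` -/

/-- The concavity gap `gap(x) = (θ(x) − x)/log x − (li(θ(x)) − li(x)) ≥ 0` of `li` between `x` and
`θ(x)` (Robin's (13)). [cite: Robin1984Toulouse, §4 (13)] -/
def liGap (x : ℝ) : ℝ := (θ x - x) / Real.log x - (logIntegral (θ x) - logIntegral x)

/-- **RH-FREE decomposition of `A − R`.** For `2 ≤ x₁ ≤ x`:
`A(x) − R(x) = J(x₁;x) + (P(x) − 2√x/log² x) − gap(x) + (D(x₁) − I(x₁)/log² x₁ + li 2)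
 + (log(2π) log x − c₀ − E₁(x))/log² x`.
All of `A`, `R`'s zero sum and `D` are driven by the same prime sum; the leading parts CANCEL.
[cite: Nicolas2022HC, §2.5 (2.41)–(2.43) with Lemma 2.5 (2.19); Robin1984Toulouse, §4 (13)] -/
theorem liThetaSubPi_sub_R_eq {x₁ x : ℝ} (hx₁ : 2 ≤ x₁) (hx : x₁ ≤ x) :
    liThetaSubPi x - R x =
      jInt x₁ x + (LiThetaRH.posPart x - 2 * Real.sqrt x / Real.log x ^ 2) - liGap x +
        (robinD x₁ - primeIntegral x₁ / Real.log x₁ ^ 2 + logIntegral 2) +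
        (Real.log (2 * π) * Real.log x - sConstRe - sErr x) / Real.log x ^ 2 := by
  have hx2 : 2 ≤ x := hx₁.trans hx
  have hA := liThetaSubPi_eq_posPart hx2
  have hD := robinD_eq_primeIntegral hx₁ hx
  have hS := re_S_eq (by linarith : (1 : ℝ) ≤ x)
  rw [hA, R, hS, hD, liGap]
  ring

/-! ### §3. Under RH: the smoothed integral `J` -/

/-- `∫_{x₁}^x dt/(√t log³ t) ≤ (2√x/log³ x)/(1 − 6/log x₁)` for `e⁶ < x₁ ≤ x` (compare with the
derivative of `2√t/log³ t`). [cite: Nicolas2022HC, §2.2 (2.16)–(2.17) (integrals of 1/(√t logᵏt))] -/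
theorem integral_inv_sqrt_log_cube_le {x₁ x : ℝ} (hx₁ : Real.exp 6 < x₁) (hx : x₁ ≤ x) :
    ∫ t in x₁..x, 1 / (Real.sqrt t * Real.log t ^ 3) ≤
      (2 * Real.sqrt x / Real.log x ^ 3) / (1 - 6 / Real.log x₁) := by
  have he : (1 : ℝ) < Real.exp 6 := by
    have := Real.add_one_le_exp (6 : ℝ); linarith
  have hx₁1 : 1 < x₁ := he.trans hx₁
  have hl₁ : 6 < Real.log x₁ := by
    rw [← Real.log_exp 6]; exact Real.log_lt_log (Real.exp_pos 6) hx₁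
  have hc : 0 < 1 - 6 / Real.log x₁ := by
    rw [sub_pos, div_lt_one (by linarith)]; exact hl₁
  -- `(2√t/log³ t)' = 1/(√t log³ t) − 6/(√t log⁴ t)`
  have hderiv : ∀ t ∈ Set.uIcc x₁ x, HasDerivAt (fun u : ℝ ↦ 2 * Real.sqrt u / Real.log u ^ 3)
      (1 / (Real.sqrt t * Real.log t ^ 3) - 6 / (Real.sqrt t * Real.log t ^ 4)) t := by
    intro t ht
    rw [Set.uIcc_of_le hx] at ht
    have ht1 : 1 < t := by linarith [ht.1]
    have ht0 : 0 < t := by linarith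
    have hst : 0 < Real.sqrt t := Real.sqrt_pos.2 ht0
    have hlt : 0 < Real.log t := Real.log_pos ht1
    have h1 : HasDerivAt (fun u : ℝ ↦ 2 * Real.sqrt u) (2 * (1 / (2 * Real.sqrt t))) t :=
      (Real.hasDerivAt_sqrt ht0.ne').const_mul 2
    have h2 : HasDerivAt (fun u : ℝ ↦ Real.log u ^ 3) (((3 : ℕ) : ℝ) * Real.log t ^ (3 - 1) * t⁻¹) t :=
      (Real.hasDerivAt_log ht0.ne').pow 3
    have h := h1.div h2 (pow_ne_zero 3 hlt.ne')
    refine h.congr_deriv ?_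
    have hsne : Real.sqrt t ≠ 0 := hst.ne'
    have hlne : Real.log t ≠ 0 := hlt.ne'
    have hst2 : Real.sqrt t ^ 2 = t := Real.sq_sqrt ht0.le
    have e : ((3 : ℕ) : ℝ) * Real.log t ^ (3 - 1) * t⁻¹ = 3 * Real.log t ^ 2 / Real.sqrt t ^ 2 := by
      norm_num; rw [div_eq_mul_inv, hst2]
    rw [e]
    field_simp
    ring
  have hl : ContinuousOn (fun t : ℝ ↦ Real.log t) (Icc x₁ x) :=
    Real.continuousOn_log.mono fun t ht ↦ by
      simp only [mem_compl_iff, mem_singleton_iff]; linarith [ht.1]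
  have hne : ∀ t ∈ Icc x₁ x, ∀ n : ℕ, Real.sqrt t * Real.log t ^ n ≠ 0 := fun t ht n ↦
    mul_ne_zero (Real.sqrt_pos.2 (by linarith [ht.1])).ne' (pow_ne_zero n (Real.log_pos (by linarith [ht.1])).ne')
  have hc3 : ContinuousOn (fun t : ℝ ↦ 1 / (Real.sqrt t * Real.log t ^ 3)) (Icc x₁ x) :=
    continuousOn_const.div (Real.continuous_sqrt.continuousOn.mul (hl.pow 3)) fun t ht ↦ hne t ht 3
  have hc4 : ContinuousOn (fun t : ℝ ↦ 6 / (Real.sqrt t * Real.log t ^ 4)) (Icc x₁ x) :=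
    continuousOn_const.div (Real.continuous_sqrt.continuousOn.mul (hl.pow 4)) fun t ht ↦ hne t ht 4
  have hi3 : IntervalIntegrable (fun t : ℝ ↦ 1 / (Real.sqrt t * Real.log t ^ 3)) volume x₁ x :=
    hc3.intervalIntegrable_of_Icc hx
  have hi' : IntervalIntegrable (fun t : ℝ ↦ 1 / (Real.sqrt t * Real.log t ^ 3) - 6 / (Real.sqrt t * Real.log t ^ 4))
      volume x₁ x := hi3.sub (hc4.intervalIntegrable_of_Icc hx)
  have hftc : ∫ t in x₁..x, (1 / (Real.sqrt t * Real.log t ^ 3) - 6 / (Real.sqrt t * Real.log t ^ 4)) =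
      2 * Real.sqrt x / Real.log x ^ 3 - 2 * Real.sqrt x₁ / Real.log x₁ ^ 3 :=
    intervalIntegral.integral_eq_sub_of_hasDerivAt hderiv hi'
  -- pointwise: `(1 − 6/log x₁)/(√t log³ t) ≤ g' t`
  have hmono : ∀ t ∈ Icc x₁ x, (1 - 6 / Real.log x₁) * (1 / (Real.sqrt t * Real.log t ^ 3)) ≤
      1 / (Real.sqrt t * Real.log t ^ 3) - 6 / (Real.sqrt t * Real.log t ^ 4) := by
    intro t ht
    have ht0 : 0 < t := by linarith [ht.1]
    have hst : 0 < Real.sqrt t := Real.sqrt_pos.2 ht0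
    have hlt : Real.log x₁ ≤ Real.log t := Real.log_le_log (by linarith) ht.1
    have hlt0 : 0 < Real.log t := by linarith
    have e : 1 / (Real.sqrt t * Real.log t ^ 3) - 6 / (Real.sqrt t * Real.log t ^ 4) =
        (1 - 6 / Real.log t) * (1 / (Real.sqrt t * Real.log t ^ 3)) := by
      have hsne : Real.sqrt t ≠ 0 := hst.ne'
      have hlne : Real.log t ≠ 0 := hlt0.ne'
      field_simp
    rw [e]
    refine mul_le_mul_of_nonneg_right ?_ (by positivity)
    have : 6 / Real.log t ≤ 6 / Real.log x₁ := div_le_div_of_nonneg_left (by norm_num) (by linarith) hlt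
    linarith
  have hle : (1 - 6 / Real.log x₁) * ∫ t in x₁..x, 1 / (Real.sqrt t * Real.log t ^ 3) ≤
      2 * Real.sqrt x / Real.log x ^ 3 - 2 * Real.sqrt x₁ / Real.log x₁ ^ 3 := by
    rw [← hftc, ← intervalIntegral.integral_const_mul]
    exact intervalIntegral.integral_mono_on hx (hi3.const_mul _) hi' hmono
  have hg₁ : 0 ≤ 2 * Real.sqrt x₁ / Real.log x₁ ^ 3 := by
    have := Real.log_pos hx₁1; positivity
  rw [le_div_iff₀ hc, mul_comm]
  linarith

/-- `∫_a^b dt/(t log² t) = 1/log a − 1/log b` (`1 < a ≤ b`). [folklore] -/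
private theorem integral_inv_mul_log_sq {a b : ℝ} (ha : 1 < a) (hab : a ≤ b) :
    ∫ t in a..b, 1 / (t * Real.log t ^ 2) = (Real.log a)⁻¹ - (Real.log b)⁻¹ := by
  have hderiv : ∀ t ∈ Set.uIcc a b, HasDerivAt (fun u : ℝ ↦ -(Real.log u)⁻¹) (1 / (t * Real.log t ^ 2)) t := by
    intro t ht
    rw [Set.uIcc_of_le hab] at ht
    have ht0 : t ≠ 0 := by linarith [ht.1]
    have hl : Real.log t ≠ 0 := (Real.log_pos (by linarith [ht.1])).ne'
    have h := ((Real.hasDerivAt_log ht0).inv hl).neg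
    refine h.congr_deriv ?_
    field_simp
  have hcont : ContinuousOn (fun t : ℝ ↦ 1 / (t * Real.log t ^ 2)) (Set.uIcc a b) := by
    rw [Set.uIcc_of_le hab]
    refine continuousOn_const.div (continuousOn_id.mul ((Real.continuousOn_log.mono fun t ht ↦ ?_).pow 2))
      fun t ht ↦ ?_
    · simp only [mem_compl_iff, mem_singleton_iff]; linarith [ht.1]
    · exact mul_ne_zero (by linarith [ht.1]) (pow_ne_zero 2 (Real.log_pos (by linarith [ht.1])).ne')
  rw [intervalIntegral.integral_eq_sub_of_hasDerivAt hderiv hcont.intervalIntegrable]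
  ring

/-- `∫_a^b dt/(t log³ t) = 1/(2 log² a) − 1/(2 log² b)` (`1 < a ≤ b`). [folklore] -/
private theorem integral_inv_mul_log_cube {a b : ℝ} (ha : 1 < a) (hab : a ≤ b) :
    ∫ t in a..b, 1 / (t * Real.log t ^ 3) = (Real.log a ^ 2)⁻¹ / 2 - (Real.log b ^ 2)⁻¹ / 2 := by
  have hderiv : ∀ t ∈ Set.uIcc a b,
      HasDerivAt (fun u : ℝ ↦ -(Real.log u ^ 2)⁻¹ / 2) (1 / (t * Real.log t ^ 3)) t := by
    intro t ht
    rw [Set.uIcc_of_le hab] at ht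
    have ht0 : t ≠ 0 := by linarith [ht.1]
    have hl : Real.log t ≠ 0 := (Real.log_pos (by linarith [ht.1])).ne'
    have h1 : HasDerivAt (fun u : ℝ ↦ Real.log u ^ 2) (((2 : ℕ) : ℝ) * Real.log t ^ (2 - 1) * t⁻¹) t :=
      (Real.hasDerivAt_log ht0).pow 2
    have h := ((h1.inv (pow_ne_zero 2 hl)).neg).div_const 2
    refine h.congr_deriv ?_
    have e : ((2 : ℕ) : ℝ) * Real.log t ^ (2 - 1) * t⁻¹ = 2 * Real.log t / t := by
      norm_num; rw [div_eq_mul_inv]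
    rw [e]
    field_simp
  have hcont : ContinuousOn (fun t : ℝ ↦ 1 / (t * Real.log t ^ 3)) (Set.uIcc a b) := by
    rw [Set.uIcc_of_le hab]
    refine continuousOn_const.div (continuousOn_id.mul ((Real.continuousOn_log.mono fun t ht ↦ ?_).pow 3))
      fun t ht ↦ ?_
    · simp only [mem_compl_iff, mem_singleton_iff]; linarith [ht.1]
    · exact mul_ne_zero (by linarith [ht.1]) (pow_ne_zero 3 (Real.log_pos (by linarith [ht.1])).ne')
  rw [intervalIntegral.integral_eq_sub_of_hasDerivAt hderiv hcont.intervalIntegrable]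
  ring

/-- **Under RH, `|J(x₁; x)| ≤ 4τ√x/(log³ x (1 − 6/log x₁)) + 2 log(2π)/log x₁ + K`** for
`e⁶ < x₁ ≤ x` (`K` an absolute constant): from `|I(t)| ≤ τ√t + log(2π) log t + K`.
[cite: Nicolas2022HC, Prop. 2.12 (2.51) (the `A₁ − S/log²` band), via Lemma 2.5 and (1.4)] -/
theorem abs_jInt_le_of_RH (hRH : RiemannHypothesis) :
    ∃ K : ℝ, 0 < K ∧ ∀ x₁ x : ℝ, Real.exp 6 < x₁ → x₁ ≤ x →
      |jInt x₁ x| ≤ 4 * nicolasBeta * Real.sqrt x / Real.log x ^ 3 / (1 - 6 / Real.log x₁) +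
        2 * Real.log (2 * π) / Real.log x₁ + K := by
  obtain ⟨K₀, hK₀, hI⟩ := exists_abs_primeIntegral_le_of_RH hRH
  refine ⟨K₀, hK₀, fun x₁ x hx₁ hx ↦ ?_⟩
  have he : (1 : ℝ) < Real.exp 6 := by
    have := Real.add_one_le_exp (6 : ℝ); linarith
  have hx₁1 : 1 < x₁ := he.trans hx₁
  have hl₁ : 6 < Real.log x₁ := by
    rw [← Real.log_exp 6]; exact Real.log_lt_log (Real.exp_pos 6) hx₁
  have hl₁0 : 0 < Real.log x₁ := by linarith
  have hc : 0 < 1 - 6 / Real.log x₁ := by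
    rw [sub_pos, div_lt_one (by linarith)]; exact hl₁
  have hβ : 0 < nicolasBeta := by have := nicolasBeta_gt; linarith
  have hl2π : 0 < Real.log (2 * π) := Real.log_pos (by linarith [Real.pi_gt_three])
  -- the dominating function
  set b : ℝ → ℝ := fun t ↦ nicolasBeta * (1 / (Real.sqrt t * Real.log t ^ 3)) +
    Real.log (2 * π) * (1 / (t * Real.log t ^ 2)) + K₀ * (1 / (t * Real.log t ^ 3)) with hb
  have hpt : ∀ᵐ t : ℝ, t ∈ Ioc x₁ x → ‖primeIntegral t / (t * Real.log t ^ 3)‖ ≤ b t := by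
    refine ae_of_all _ fun t ht ↦ ?_
    have ht1 : 1 < t := by linarith [ht.1]
    have ht0 : 0 < t := by linarith
    have hlt : 0 < Real.log t := Real.log_pos ht1
    have hst : 0 < Real.sqrt t := Real.sqrt_pos.2 ht0
    have hst2 : Real.sqrt t * Real.sqrt t = t := Real.mul_self_sqrt ht0.le
    have h := hI t ht1.le
    rw [Real.norm_eq_abs, abs_div, abs_of_pos (by positivity : 0 < t * Real.log t ^ 3),
      div_le_iff₀ (by positivity)]
    have e : b t * (t * Real.log t ^ 3) =
        nicolasBeta * Real.sqrt t + Real.log (2 * π) * Real.log t + K₀ := by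
      have hsne : Real.sqrt t ≠ 0 := hst.ne'
      have hlne : Real.log t ≠ 0 := hlt.ne'
      have htne : t ≠ 0 := ht0.ne'
      have e1 : t = Real.sqrt t * Real.sqrt t := hst2.symm
      have h_a : 1 / (Real.sqrt t * Real.log t ^ 3) * (t * Real.log t ^ 3) = Real.sqrt t := by
        rw [one_div_mul_eq_div, mul_div_mul_right _ _ (pow_ne_zero 3 hlne)]
        exact div_eq_of_eq_mul hsne e1
      have h_b : 1 / (t * Real.log t ^ 2) * (t * Real.log t ^ 3) = Real.log t := by
        rw [one_div_mul_eq_div, show t * Real.log t ^ 3 = (t * Real.log t ^ 2) * Real.log t by ring,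
          mul_div_cancel_left₀ _ (mul_ne_zero htne (pow_ne_zero 2 hlne))]
      have h_c : 1 / (t * Real.log t ^ 3) * (t * Real.log t ^ 3) = 1 := by
        rw [one_div_mul_eq_div, div_self (mul_ne_zero htne (pow_ne_zero 3 hlne))]
      rw [hb]
      show (nicolasBeta * (1 / (Real.sqrt t * Real.log t ^ 3)) + Real.log (2 * π) * (1 / (t * Real.log t ^ 2)) +
        K₀ * (1 / (t * Real.log t ^ 3))) * (t * Real.log t ^ 3) = _
      rw [add_mul, add_mul, mul_assoc, h_a, mul_assoc, h_b, mul_assoc, h_c, mul_one]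
    rw [e]
    exact h
  -- integrability
  have hlc : ContinuousOn (fun t : ℝ ↦ Real.log t) (Icc x₁ x) :=
    Real.continuousOn_log.mono fun t ht ↦ by
      simp only [mem_compl_iff, mem_singleton_iff]; linarith [ht.1]
  have hne : ∀ t ∈ Icc x₁ x, 0 < t ∧ 0 < Real.log t := fun t ht ↦
    ⟨by linarith [ht.1], Real.log_pos (by linarith [ht.1])⟩
  have hi1 : IntervalIntegrable (fun t : ℝ ↦ 1 / (Real.sqrt t * Real.log t ^ 3)) volume x₁ x :=
    (continuousOn_const.div (Real.continuous_sqrt.continuousOn.mul (hlc.pow 3)) fun t ht ↦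
      mul_ne_zero (Real.sqrt_pos.2 (hne t ht).1).ne' (pow_ne_zero 3 (hne t ht).2.ne')).intervalIntegrable_of_Icc hx
  have hi2 : IntervalIntegrable (fun t : ℝ ↦ 1 / (t * Real.log t ^ 2)) volume x₁ x :=
    (continuousOn_const.div (continuousOn_id.mul (hlc.pow 2)) fun t ht ↦
      mul_ne_zero (hne t ht).1.ne' (pow_ne_zero 2 (hne t ht).2.ne')).intervalIntegrable_of_Icc hx
  have hi3 : IntervalIntegrable (fun t : ℝ ↦ 1 / (t * Real.log t ^ 3)) volume x₁ x :=
    (continuousOn_const.div (continuousOn_id.mul (hlc.pow 3)) fun t ht ↦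
      mul_ne_zero (hne t ht).1.ne' (pow_ne_zero 3 (hne t ht).2.ne')).intervalIntegrable_of_Icc hx
  have hbi : IntervalIntegrable b volume x₁ x :=
    ((hi1.const_mul _).add (hi2.const_mul _)).add (hi3.const_mul _)
  -- `|∫ f| ≤ ∫ b`
  have hmain := intervalIntegral.norm_integral_le_of_norm_le hx hpt hbi
  rw [Real.norm_eq_abs] at hmain
  have hsplit : ∫ t in x₁..x, b t =
      nicolasBeta * (∫ t in x₁..x, 1 / (Real.sqrt t * Real.log t ^ 3)) +
      Real.log (2 * π) * (∫ t in x₁..x, 1 / (t * Real.log t ^ 2)) +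
      K₀ * (∫ t in x₁..x, 1 / (t * Real.log t ^ 3)) := by
    rw [hb, intervalIntegral.integral_add ((hi1.const_mul _).add (hi2.const_mul _)) (hi3.const_mul _),
      intervalIntegral.integral_add (hi1.const_mul _) (hi2.const_mul _),
      intervalIntegral.integral_const_mul, intervalIntegral.integral_const_mul,
      intervalIntegral.integral_const_mul]
  have hI1 := integral_inv_sqrt_log_cube_le hx₁ hx
  have hI2 : ∫ t in x₁..x, 1 / (t * Real.log t ^ 2) ≤ (Real.log x₁)⁻¹ := by
    rw [integral_inv_mul_log_sq hx₁1 hx]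
    have : 0 ≤ (Real.log x)⁻¹ := inv_nonneg.2 (Real.log_nonneg (by linarith))
    linarith
  have hI3 : ∫ t in x₁..x, 1 / (t * Real.log t ^ 3) ≤ 1 / 2 := by
    rw [integral_inv_mul_log_cube hx₁1 hx]
    have h1 : (Real.log x₁ ^ 2)⁻¹ ≤ 1 := by
      rw [inv_le_one₀ (by positivity)]; nlinarith
    have h2 : 0 ≤ (Real.log x ^ 2)⁻¹ := by positivity
    linarith
  have hJ : |jInt x₁ x| = 2 * |∫ t in x₁..x, primeIntegral t / (t * Real.log t ^ 3)| := by
    rw [jInt, abs_mul, abs_of_pos two_pos]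
  rw [hJ]
  have hsx : 0 ≤ Real.sqrt x := Real.sqrt_nonneg x
  have hlx : 0 < Real.log x := Real.log_pos (by linarith)
  calc 2 * |∫ t in x₁..x, primeIntegral t / (t * Real.log t ^ 3)| ≤ 2 * ∫ t in x₁..x, b t := by
        linarith
    _ = 2 * (nicolasBeta * (∫ t in x₁..x, 1 / (Real.sqrt t * Real.log t ^ 3)) +
          Real.log (2 * π) * (∫ t in x₁..x, 1 / (t * Real.log t ^ 2)) +
          K₀ * (∫ t in x₁..x, 1 / (t * Real.log t ^ 3))) := by rw [hsplit]
    _ ≤ 2 * (nicolasBeta * ((2 * Real.sqrt x / Real.log x ^ 3) / (1 - 6 / Real.log x₁)) +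
          Real.log (2 * π) * (Real.log x₁)⁻¹ + K₀ * (1 / 2)) := by
        gcongr
    _ = 4 * nicolasBeta * Real.sqrt x / Real.log x ^ 3 / (1 - 6 / Real.log x₁) +
          2 * Real.log (2 * π) / Real.log x₁ + K₀ := by
        field_simp
        ring

/-! ### §4. Under RH: the prime-power term `P(x) = 2√x/log² x + 8√x/log³ x + o(√x/log³ x)` -/

/-- `li(y) − y/log y − y/log² y − 2y/log³ y = 6 Li₄(y) + const` for `y > 1` (three integrations
by parts). [cite: Nicolas2022HC, §2.2 (2.13)–(2.15) (asymptotic expansion of li)] -/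
theorem logIntegral_sub_three_terms {y : ℝ} (hy : 1 < y) :
    logIntegral y - y / Real.log y - y / Real.log y ^ 2 - 2 * y / Real.log y ^ 3 =
      6 * offsetLogIntegralPow 4 y +
        (logIntegral 2 - 2 / Real.log 2 - 2 / Real.log 2 ^ 2 - 4 / Real.log 2 ^ 3) := by
  have h2 := logIntegral_sub_two_terms hy
  have h3 := offsetLogIntegralPow_integration_by_parts 3 hy
  simp only [Nat.cast_ofNat] at h3
  have e : logIntegral y - y / Real.log y - y / Real.log y ^ 2 - 2 * y / Real.log y ^ 3 =
      (logIntegral y - y / Real.log y - y / Real.log y ^ 2) - 2 * y / Real.log y ^ 3 := by ring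
  rw [e, h2, h3]
  simp only [inv_pow, div_eq_mul_inv]
  ring

/-- `log y ^ k = o(y^s)`-type comparison: `(log y)^a · y^{1/2} = o(y/log³ y)` packaged as
`√y log y = o(y/log³ y)`. [folklore] -/
private theorem isLittleO_sqrt_mul_log_div_log_cube :
    (fun y : ℝ ↦ Real.sqrt y * Real.log y) =o[atTop] fun y ↦ y / Real.log y ^ 3 := by
  have h1 : (fun y : ℝ ↦ Real.log y ^ (4 : ℝ)) =o[atTop] fun y ↦ y ^ (1 / 2 : ℝ) :=
    isLittleO_log_rpow_rpow_atTop 4 (by norm_num)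
  have h2 := h1.mul_isBigO (isBigO_refl (fun y : ℝ ↦ Real.sqrt y / Real.log y ^ 3) atTop)
  refine h2.congr' ?_ ?_
  · filter_upwards [eventually_gt_atTop 1] with y hy
    have hl : Real.log y ≠ 0 := (Real.log_pos hy).ne'
    rw [show (Real.log y ^ (4 : ℝ)) = Real.log y ^ 4 by norm_cast]
    field_simp
  · filter_upwards [eventually_gt_atTop 1] with y hy
    have hl : Real.log y ≠ 0 := (Real.log_pos hy).ne'
    have hy0 : 0 ≤ y := by linarith
    rw [← Real.sqrt_eq_rpow]
    have : Real.sqrt y * Real.sqrt y = y := Real.mul_self_sqrt hy0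
    field_simp
    nlinarith [this]

/-- **Under RH, `B(y) = y/log² y + 2y/log³ y + o(y/log³ y)`** (`B(y) = π(y) − θ(y)/log y`; from
`π = li + O(√y log y)`, `θ = y + O(√y log² y)` and the expansion of `li`).
[cite: Nicolas2022HC, §2.5 (2.48)–(2.50) (the functions F̃₁, F̃₂); Nicolas2017, Lemma 3.3] -/
theorem nicolasB_second_order_of_RH (hRH : RiemannHypothesis) :
    (fun y : ℝ ↦ nicolasB y - y / Real.log y ^ 2 - 2 * y / Real.log y ^ 3) =o[atTop]
      fun y ↦ y / Real.log y ^ 3 := by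
  have hπ := primeCounting_sub_logIntegral_isBigO_of_riemannHypothesis hRH
  have hθ : (fun y : ℝ ↦ θ y - y) =O[atTop] fun y ↦ y ^ (1 / 2 : ℝ) * Real.log y ^ 2 :=
    riemannHypothesis_iff_chebyshevTheta_isBigO_holds.mp hRH
  have e1 : (fun y : ℝ ↦ (Nat.primeCounting ⌊y⌋₊ : ℝ) - logIntegral y) =o[atTop] fun y ↦ y / Real.log y ^ 3 :=
    hπ.trans_isLittleO isLittleO_sqrt_mul_log_div_log_cube
  have e2 : (fun y : ℝ ↦ logIntegral y - y / Real.log y - y / Real.log y ^ 2 - 2 * y / Real.log y ^ 3)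
      =o[atTop] fun y ↦ y / Real.log y ^ 3 := by
    have hLi : offsetLogIntegralPow 4 =O[atTop] fun y ↦ y / Real.log y ^ 4 :=
      (isEquivalent_offsetLogIntegralPow_holds 4).isBigO
    have hsmall : (fun y : ℝ ↦ y / Real.log y ^ 4) =o[atTop] fun y ↦ y / Real.log y ^ 3 := by
      have h1 : (fun y : ℝ ↦ (Real.log y)⁻¹) =o[atTop] fun _ ↦ (1 : ℝ) := by
        rw [isLittleO_one_iff]
        exact tendsto_inv_atTop_zero.comp Real.tendsto_log_atTop
      have h2 := h1.mul_isBigO (isBigO_refl (fun y : ℝ ↦ y / Real.log y ^ 3) atTop)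
      refine h2.congr' ?_ (Eventually.of_forall fun y ↦ by simp)
      filter_upwards [eventually_gt_atTop 1] with y hy
      have hl : Real.log y ≠ 0 := (Real.log_pos hy).ne'
      field_simp
    have hconst : (fun _ : ℝ ↦ (1 : ℝ)) =o[atTop] fun y ↦ y / Real.log y ^ 3 := by
      have h1 : (fun y : ℝ ↦ Real.log y ^ (3 : ℝ)) =o[atTop] fun y ↦ y ^ (1 : ℝ) :=
        isLittleO_log_rpow_rpow_atTop 3 one_pos
      have h2 := h1.mul_isBigO (isBigO_refl (fun y : ℝ ↦ (Real.log y ^ 3)⁻¹) atTop)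
      refine h2.congr' ?_ ?_
      · filter_upwards [eventually_gt_atTop 1] with y hy
        have hl : Real.log y ≠ 0 := (Real.log_pos hy).ne'
        rw [show (Real.log y ^ (3 : ℝ)) = Real.log y ^ 3 by norm_cast]
        field_simp
      · exact Eventually.of_forall fun y ↦ by simp [div_eq_mul_inv]
    have h3 := ((hLi.trans_isLittleO hsmall).const_mul_left 6).add
      (hconst.const_mul_left (logIntegral 2 - 2 / Real.log 2 - 2 / Real.log 2 ^ 2 - 4 / Real.log 2 ^ 3))
    refine h3.congr' ?_ (Eventually.of_forall fun _ ↦ rfl)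
    filter_upwards [eventually_gt_atTop 1] with y hy
    rw [logIntegral_sub_three_terms hy]
    simp
  have e3 : (fun y : ℝ ↦ (θ y - y) / Real.log y) =o[atTop] fun y ↦ y / Real.log y ^ 3 := by
    have h5 : (fun y : ℝ ↦ (θ y - y) / Real.log y) =O[atTop] fun y ↦ Real.sqrt y * Real.log y := by
      refine (hθ.mul (isBigO_refl (fun y : ℝ ↦ (Real.log y)⁻¹) atTop)).congr' ?_ ?_
      · exact Eventually.of_forall fun y ↦ by simp [div_eq_mul_inv]
      · filter_upwards [eventually_gt_atTop 1] with y hy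
        have hl : Real.log y ≠ 0 := (Real.log_pos hy).ne'
        rw [← Real.sqrt_eq_rpow]
        field_simp
    exact h5.trans_isLittleO isLittleO_sqrt_mul_log_div_log_cube
  have hsum := (e1.add e2).sub e3
  refine hsum.congr' ?_ (Eventually.of_forall fun _ ↦ rfl)
  filter_upwards [eventually_gt_atTop 1] with y hy
  have hl : Real.log y ≠ 0 := (Real.log_pos hy).ne'
  simp only [nicolasB]
  field_simp
  ring

/-- **Under RH, `P(x) = 2√x/log² x + 8√x/log³ x + o(√x/log³ x)`** (`P = B(√x)/2 + O(x^{1/3} log x)`,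
tree `posPart_bounds`, and `B` to second order at `√x`: `log √x = (log x)/2` turns `y/log² y + 2y/log³ y`
into `4√x/log² x + 16√x/log³ x`). [cite: Nicolas2022HC, Prop. 2.12 (2.52) (the A₂ band 2√x/log²x + [5.32, 24.77]√x/log³x)] -/
theorem posPart_second_order_of_RH (hRH : RiemannHypothesis) :
    (fun x : ℝ ↦ LiThetaRH.posPart x - 2 * Real.sqrt x / Real.log x ^ 2 - 8 * Real.sqrt x / Real.log x ^ 3)
      =o[atTop] fun x ↦ Real.sqrt x / Real.log x ^ 3 := by
  -- the tail `P − B(√x)/2 = O(x^{1/3} log x)`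
  have htail : (fun x : ℝ ↦ LiThetaRH.posPart x - nicolasB (Real.sqrt x) / 2) =o[atTop]
      fun x ↦ Real.sqrt x / Real.log x ^ 3 := by
    have hbig : (fun x : ℝ ↦ LiThetaRH.posPart x - nicolasB (Real.sqrt x) / 2) =O[atTop]
        fun x ↦ Real.log x / Real.log 2 * x ^ ((1 : ℝ) / 3) := by
      refine IsBigO.of_bound 1 ?_
      filter_upwards [eventually_ge_atTop 4] with x hx
      have h := posPart_bounds hx
      have hl : 0 ≤ Real.log x / Real.log 2 * x ^ ((1 : ℝ) / 3) := by
        have := Real.log_nonneg (by linarith : (1 : ℝ) ≤ x)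
        have := Real.log_pos one_lt_two
        positivity
      rw [Real.norm_eq_abs, Real.norm_eq_abs, abs_of_nonneg (by linarith [h.1]), abs_of_nonneg hl, one_mul]
      linarith [h.2]
    have hsmall : (fun x : ℝ ↦ Real.log x / Real.log 2 * x ^ ((1 : ℝ) / 3)) =o[atTop]
        fun x ↦ Real.sqrt x / Real.log x ^ 3 := by
      have h1 : (fun x : ℝ ↦ Real.log x ^ (4 : ℝ)) =o[atTop] fun x ↦ x ^ (1 / 6 : ℝ) :=
        isLittleO_log_rpow_rpow_atTop 4 (by norm_num)
      have h2 := (h1.mul_isBigO (isBigO_refl (fun x : ℝ ↦ x ^ ((1 : ℝ) / 3) / Real.log x ^ 3) atTop)).const_mul_left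
        (1 / Real.log 2)
      refine h2.congr' ?_ ?_
      · filter_upwards [eventually_gt_atTop 1] with x hx
        have hl : Real.log x ≠ 0 := (Real.log_pos hx).ne'
        have hl2 : Real.log 2 ≠ 0 := (Real.log_pos one_lt_two).ne'
        rw [show (Real.log x ^ (4 : ℝ)) = Real.log x ^ 4 by norm_cast]
        field_simp
      · filter_upwards [eventually_gt_atTop 1] with x hx
        have hx0 : 0 < x := by linarith
        have e : x ^ (1 / 6 : ℝ) * x ^ ((1 : ℝ) / 3) = Real.sqrt x := by
          rw [← Real.rpow_add hx0, Real.sqrt_eq_rpow]; norm_num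
        rw [← e]
        ring
    exact hbig.trans_isLittleO hsmall
  -- the main term through `√x`
  have hB := (nicolasB_second_order_of_RH hRH).comp_tendsto Real.tendsto_sqrt_atTop
  have hB' : (fun x : ℝ ↦ nicolasB (Real.sqrt x) / 2 - 2 * Real.sqrt x / Real.log x ^ 2 -
      8 * Real.sqrt x / Real.log x ^ 3) =o[atTop] fun x ↦ Real.sqrt x / Real.log x ^ 3 := by
    have h1 : (fun x : ℝ ↦ nicolasB (Real.sqrt x) / 2 - 2 * Real.sqrt x / Real.log x ^ 2 -
        8 * Real.sqrt x / Real.log x ^ 3) =ᶠ[atTop]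
        fun x ↦ (1 / 2 : ℝ) * ((fun y : ℝ ↦ nicolasB y - y / Real.log y ^ 2 - 2 * y / Real.log y ^ 3) ∘
          Real.sqrt) x := by
      filter_upwards [eventually_gt_atTop 1] with x hx
      have hx0 : 0 < x := by linarith
      have hls : Real.log (Real.sqrt x) = Real.log x / 2 := by
        rw [Real.sqrt_eq_rpow, Real.log_rpow hx0]; ring
      simp only [Function.comp, hls]
      have hl : Real.log x ≠ 0 := (Real.log_pos hx).ne'
      field_simp
      ring
    have h2 : (fun x : ℝ ↦ ((fun y : ℝ ↦ y / Real.log y ^ 3) ∘ Real.sqrt) x) =O[atTop]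
        fun x ↦ Real.sqrt x / Real.log x ^ 3 := by
      refine IsBigO.of_bound 8 ?_
      filter_upwards [eventually_gt_atTop 1] with x hx
      have hx0 : 0 < x := by linarith
      have hls : Real.log (Real.sqrt x) = Real.log x / 2 := by
        rw [Real.sqrt_eq_rpow, Real.log_rpow hx0]; ring
      have hl : 0 < Real.log x := Real.log_pos hx
      simp only [Function.comp, hls]
      rw [Real.norm_eq_abs, Real.norm_eq_abs, abs_of_nonneg (by positivity), abs_of_nonneg (by positivity)]
      apply le_of_eq
      field_simp
      ring
    refine (IsLittleO.trans_isBigO ?_ h2 |>.const_mul_left (1 / 2 : ℝ)).congr' h1.symm (Eventually.of_forall fun _ ↦ rfl)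
    exact hB
  have hsum := htail.add hB'
  refine hsum.congr' ?_ (Eventually.of_forall fun _ ↦ rfl)
  exact Eventually.of_forall fun x ↦ by ring

/-! ### §5. Prop. 2.12 (2.53) under RH, asymptotic form -/

/-- `log^k x = o(√x/log³ x)`-type absorption: for every `C` and every `c > 0`, eventually
`C log² x ≤ c √x/log³ x`. [folklore] -/
private theorem eventually_log_sq_le {C c : ℝ} (hc : 0 < c) :
    ∀ᶠ x : ℝ in atTop, C * Real.log x ^ 2 ≤ c * (Real.sqrt x / Real.log x ^ 3) := by
  have h1 : (fun x : ℝ ↦ Real.log x ^ (5 : ℝ)) =o[atTop] fun x ↦ x ^ (1 / 2 : ℝ) :=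
    isLittleO_log_rpow_rpow_atTop 5 (by norm_num)
  have h2 : (fun x : ℝ ↦ C * Real.log x ^ 2) =o[atTop] fun x ↦ Real.sqrt x / Real.log x ^ 3 := by
    have h3 := (h1.mul_isBigO (isBigO_refl (fun x : ℝ ↦ (Real.log x ^ 3)⁻¹) atTop)).const_mul_left C
    refine h3.congr' ?_ ?_
    · filter_upwards [eventually_gt_atTop 1] with x hx
      have hl : Real.log x ≠ 0 := (Real.log_pos hx).ne'
      rw [show (Real.log x ^ (5 : ℝ)) = Real.log x ^ 5 by norm_cast]
      field_simp
    · exact Eventually.of_forall fun x ↦ by simp only [Real.sqrt_eq_rpow, div_eq_mul_inv]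
  filter_upwards [h2.def hc, eventually_gt_atTop 1] with x hx hx1
  have hl : 0 < Real.log x := Real.log_pos hx1
  have hW : 0 ≤ Real.sqrt x / Real.log x ^ 3 := div_nonneg (Real.sqrt_nonneg _) (pow_nonneg hl.le 3)
  rw [Real.norm_eq_abs, Real.norm_eq_abs, abs_of_nonneg hW] at hx
  exact (le_abs_self _).trans hx

/-- Bookkeeping for Prop. 2.12: the five pieces of `A − R − 8√x/log³ x` against the weight
`W = √x/log³ x`. [folklore] -/
private theorem abs_five_pieces_le {J P G c₁ c₂ W Cj C₂ C₃ lam ε : ℝ} (hε : 0 ≤ ε) (hW : 0 ≤ W)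
    (h1 : |J| ≤ (4 * lam + ε / 2) * W + Cj) (h2 : |P| ≤ ε / 8 * W) (h3 : 0 ≤ G ∧ G ≤ ε / 8 * W)
    (h4 : |c₁| ≤ C₂) (h5 : |c₂| ≤ C₃) (hc : Cj + C₂ + C₃ ≤ ε / 8 * W) :
    |J + P - G + c₁ + c₂| ≤ (4 * lam + ε) * W := by
  have hεW : 0 ≤ ε * W := mul_nonneg hε hW
  obtain ⟨h1a, h1b⟩ := abs_le.1 h1
  obtain ⟨h2a, h2b⟩ := abs_le.1 h2
  obtain ⟨h4a, h4b⟩ := abs_le.1 h4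
  obtain ⟨h5a, h5b⟩ := abs_le.1 h5
  obtain ⟨h3a, h3b⟩ := h3
  rw [abs_le]
  constructor <;> nlinarith

/-- **Nicolas 2022, Prop. 2.12 (2.53), asymptotic form under RH**: for every `ε > 0`, eventually
`|A(x) − R(x) − 8√x/log³ x| ≤ (4τ + ε) √x/log³ x` (`A = li(θ(x)) − π(x)`, `R = (2√x + S(x))/log² x`,
`τ = ∑_ρ 1/|ρ|²`). Printed: `R(x) + 5.12√x/log³x ≤ A(x) ≤ R(x) + 25.3√x/log³x` for `x ≥ 10⁸`, and
the band `[7.99, 8.01]` in (4.22). [cite: Nicolas2022HC, Prop. 2.12 (2.53); §4.5 (4.22)] -/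
theorem prop_2_12_of_RH (hRH : RiemannHypothesis) {ε : ℝ} (hε : 0 < ε) :
    ∀ᶠ x : ℝ in atTop, |liThetaSubPi x - R x - 8 * Real.sqrt x / Real.log x ^ 3| ≤
      (4 * nicolasBeta + ε) * (Real.sqrt x / Real.log x ^ 3) := by
  have hβ : 0 < nicolasBeta := by have := nicolasBeta_gt; linarith
  obtain ⟨K, hK, hJ⟩ := abs_jInt_le_of_RH hRH
  obtain ⟨K₁, hK₁, hE⟩ := exists_abs_sErr_le
  obtain ⟨Kg, hKg, hgap⟩ := eventually_gap_bounds hRH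
  -- choice of `x₁`: `6/log x₁ = δ₀ ≤ min(1/2, ε/(16τ))`
  obtain ⟨δ₀, hδ₀pos, hδ₀le, hδ₀le'⟩ : ∃ δ₀ : ℝ, 0 < δ₀ ∧ δ₀ ≤ 1 / 2 ∧ δ₀ ≤ ε / (16 * nicolasBeta) :=
    ⟨min (1 / 2) (ε / (16 * nicolasBeta)), lt_min (by norm_num) (by positivity), min_le_left _ _,
      min_le_right _ _⟩
  obtain ⟨x₁, hlx₁, hx₁gt, hx₁2⟩ : ∃ x₁ : ℝ, Real.log x₁ = 6 / δ₀ ∧ Real.exp 6 < x₁ ∧ 2 ≤ x₁ := by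
    refine ⟨Real.exp (6 / δ₀), Real.log_exp _, ?_, ?_⟩
    · rw [Real.exp_lt_exp, lt_div_iff₀ hδ₀pos]
      nlinarith
    · have h1 : (6 : ℝ) ≤ 6 / δ₀ := by
        rw [le_div_iff₀ hδ₀pos]; nlinarith
      have h2 : (1 : ℝ) + 6 ≤ Real.exp 6 := by have := Real.add_one_le_exp (6 : ℝ); linarith
      have h3 : Real.exp 6 ≤ Real.exp (6 / δ₀) := Real.exp_le_exp.2 h1
      linarith
  have h6 : 6 / Real.log x₁ = δ₀ := by
    rw [hlx₁]; field_simp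
  have hcoef : 4 * nicolasBeta / (1 - 6 / Real.log x₁) ≤ 4 * nicolasBeta + ε / 2 := by
    rw [h6, div_le_iff₀ (by linarith)]
    have h16 : δ₀ * (16 * nicolasBeta) ≤ ε := (le_div_iff₀ (by positivity)).1 hδ₀le'
    have hεδ : ε * δ₀ ≤ ε * (1 / 2) := mul_le_mul_of_nonneg_left hδ₀le hε.le
    nlinarith
  have hlx₁0 : 0 < Real.log x₁ := by rw [hlx₁]; positivity
  -- constants
  obtain ⟨C₂, hC₂⟩ : ∃ C₂ : ℝ, |robinD x₁ - primeIntegral x₁ / Real.log x₁ ^ 2 + logIntegral 2| ≤ C₂ := ⟨_, le_rfl⟩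
  set C₃ : ℝ := Real.log (2 * π) + |sConstRe| + K₁ with hC₃
  have hl2π : 0 < Real.log (2 * π) := Real.log_pos (by linarith [Real.pi_gt_three])
  have hC₂0 : 0 ≤ C₂ := (abs_nonneg _).trans hC₂
  -- the events
  have hP := (posPart_second_order_of_RH hRH).def (by positivity : 0 < ε / 8)
  have hsmall := eventually_log_sq_le (C := 8 * Kg ^ 2) (by positivity : 0 < ε / 8)
  have hconst : ∀ᶠ x : ℝ in atTop, (2 * Real.log (2 * π) / Real.log x₁ + K) + C₂ + C₃ ≤
      ε / 8 * (Real.sqrt x / Real.log x ^ 3) := by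
    have h := eventually_log_sq_le (C := (2 * Real.log (2 * π) / Real.log x₁ + K) + C₂ + C₃)
      (by positivity : 0 < ε / 8)
    filter_upwards [h, eventually_ge_atTop (Real.exp 1)] with x hx hxe
    have hl1 : 1 ≤ Real.log x := by
      rw [← Real.log_exp 1]; exact Real.log_le_log (Real.exp_pos 1) hxe
    have hpos : 0 ≤ (2 * Real.log (2 * π) / Real.log x₁ + K) + C₂ + C₃ := by positivity
    have hl2 : (1 : ℝ) ≤ Real.log x ^ 2 := by nlinarith
    have hmul := mul_le_mul_of_nonneg_left hl2 hpos
    linarith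
  filter_upwards [hP, hsmall, hconst, hgap, eventually_ge_atTop x₁, eventually_ge_atTop (Real.exp 1)]
    with x hPx hsx hcx hgx hxx₁ hxe
  have hx1 : 1 < x := by
    have : (1 : ℝ) < Real.exp 1 := by have := Real.add_one_le_exp (1 : ℝ); linarith
    linarith
  have hlx0 : 0 < Real.log x := Real.log_pos hx1
  have hlx : 1 ≤ Real.log x := by
    rw [← Real.log_exp 1]; exact Real.log_le_log (Real.exp_pos 1) hxe
  have hW : 0 ≤ Real.sqrt x / Real.log x ^ 3 := div_nonneg (Real.sqrt_nonneg _) (pow_nonneg hlx0.le 3)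
  -- bounds on the pieces
  have h1 : |jInt x₁ x| ≤ (4 * nicolasBeta + ε / 2) * (Real.sqrt x / Real.log x ^ 3) +
      (2 * Real.log (2 * π) / Real.log x₁ + K) := by
    have h := hJ x₁ x hx₁gt hxx₁
    have e : 4 * nicolasBeta * Real.sqrt x / Real.log x ^ 3 / (1 - 6 / Real.log x₁) =
        4 * nicolasBeta / (1 - 6 / Real.log x₁) * (Real.sqrt x / Real.log x ^ 3) := by ring
    have hmain : 4 * nicolasBeta * Real.sqrt x / Real.log x ^ 3 / (1 - 6 / Real.log x₁) ≤
        (4 * nicolasBeta + ε / 2) * (Real.sqrt x / Real.log x ^ 3) := by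
      rw [e]; exact mul_le_mul_of_nonneg_right hcoef hW
    linarith
  have h2 : |LiThetaRH.posPart x - 2 * Real.sqrt x / Real.log x ^ 2 - 8 * Real.sqrt x / Real.log x ^ 3| ≤
      ε / 8 * (Real.sqrt x / Real.log x ^ 3) := by
    have := hPx
    rw [Real.norm_eq_abs, Real.norm_eq_abs, abs_of_nonneg hW] at this
    exact this
  have h3 : 0 ≤ liGap x ∧ liGap x ≤ ε / 8 * (Real.sqrt x / Real.log x ^ 3) :=
    ⟨hgx.2.1, hgx.2.2.trans hsx⟩
  have h5 : |(Real.log (2 * π) * Real.log x - sConstRe - sErr x) / Real.log x ^ 2| ≤ C₃ := by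
    have hEx := hE x hx1.le
    have hl2pos : 0 < Real.log x ^ 2 := pow_pos hlx0 2
    rw [abs_div, abs_of_pos hl2pos, div_le_iff₀ hl2pos]
    have hl2 : 1 ≤ Real.log x ^ 2 := by nlinarith
    calc |Real.log (2 * π) * Real.log x - sConstRe - sErr x|
        ≤ |Real.log (2 * π) * Real.log x - sConstRe| + |sErr x| := abs_sub _ _
      _ ≤ (|Real.log (2 * π) * Real.log x| + |sConstRe|) + K₁ := add_le_add (abs_sub _ _) hEx
      _ = Real.log (2 * π) * Real.log x + |sConstRe| + K₁ := by
          rw [abs_of_nonneg (by positivity)]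
      _ ≤ C₃ * Real.log x ^ 2 := by
          rw [hC₃]
          have hlx2 : Real.log x ≤ Real.log x ^ 2 := by nlinarith
          have i1 := mul_le_mul_of_nonneg_left hlx2 hl2π.le
          have i2 := mul_le_mul_of_nonneg_left hl2 (abs_nonneg sConstRe)
          have i3 := mul_le_mul_of_nonneg_left hl2 hK₁.le
          linarith
  -- assemble
  have e : liThetaSubPi x - R x - 8 * Real.sqrt x / Real.log x ^ 3 =
      jInt x₁ x + (LiThetaRH.posPart x - 2 * Real.sqrt x / Real.log x ^ 2 - 8 * Real.sqrt x / Real.log x ^ 3) -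
        liGap x + (robinD x₁ - primeIntegral x₁ / Real.log x₁ ^ 2 + logIntegral 2) +
        (Real.log (2 * π) * Real.log x - sConstRe - sErr x) / Real.log x ^ 2 := by
    rw [liThetaSubPi_sub_R_eq hx₁2 hxx₁]; ring
  rw [e]
  exact abs_five_pieces_le hε.le hW h1 h2 h3 hC₂ h5 hcx

/-! ### §6. The two-level numbers `N(ξ) = ξ# · (ξ^{β₂})#` (RH-free combinatorics)

Ramanujan's superior highly composite numbers have the shape `∏_k ∏_{p ≤ ξ^{β_k}} p`; for
Theorem 1.1 (iii) the first two levels suffice. -/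

/-- `0 < β₂ = log(3/2)/log 2 < 3/4`. [cite: Nicolas2022HC, (1.2), (1.7) (β₂ = 0.584…)] -/
theorem beta_two_bounds : 0 < beta 2 ∧ beta 2 < 3 / 4 := by
  have hl2 : 0 < Real.log 2 := Real.log_pos one_lt_two
  have e : beta 2 = Real.log (3 / 2) / Real.log 2 := by rw [beta]; norm_num
  rw [e]
  constructor
  · exact div_pos (Real.log_pos (by norm_num)) hl2
  · rw [div_lt_iff₀ hl2]
    -- `log(3/2) < (3/4) log 2 ⟸ (3/2)^4 < 2^3`
    have h3 : Real.log ((3 / 2 : ℝ) ^ 4) < Real.log ((2 : ℝ) ^ 3) :=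
      Real.log_lt_log (by positivity) (by norm_num)
    rw [Real.log_pow, Real.log_pow] at h3
    push_cast at h3
    linarith

/-- `β₂ = log 3/log 2 − 1`. [cite: Nicolas2022HC, (1.7)] -/
theorem beta_two_eq : beta 2 = Real.log 3 / Real.log 2 - 1 := by
  have hl2 : Real.log 2 ≠ 0 := (Real.log_pos one_lt_two).ne'
  rw [beta, show (1 : ℝ) + 1 / (2 : ℕ) = 3 / 2 by norm_num,
    Real.log_div (by norm_num) (by norm_num)]
  field_simp

/-- The two-level number `N(ξ) = ξ# · (ξ^{β₂})# = ∏_{p ≤ ξ^{β₂}} p² · ∏_{ξ^{β₂} < p ≤ ξ} p`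
(the first two levels of Ramanujan's superior highly composite numbers).
[cite: Nicolas2022HC, Def. 3.9 (3.12)–(3.13) (levels `ξ_k = ξ^{β_k}`; here `k ≤ 2`) and
Prop. 3.10 (3.17), (3.15)–(3.16)] -/
def twoLevel (ξ : ℝ) : ℕ := primorial ⌊ξ⌋₊ * primorial ⌊ξ ^ beta 2⌋₊

/-- `N(ξ) ≠ 0`. [folklore] -/
private theorem twoLevel_ne_zero (ξ : ℝ) : twoLevel ξ ≠ 0 :=
  mul_ne_zero (primorial_ne_zero _) (primorial_ne_zero _)

/-- **`log N(ξ) = θ(ξ) + θ(ξ^{β₂})`** (Nicolas's (3.17)/(3.15) with two levels).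
[cite: Nicolas2022HC, Prop. 3.10 (3.15), (3.17)] -/
theorem log_twoLevel (ξ : ℝ) : Real.log (twoLevel ξ : ℝ) = θ ξ + θ (ξ ^ beta 2) := by
  rw [twoLevel, Nat.cast_mul, Real.log_mul, Chebyshev.theta_eq_log_primorial,
    Chebyshev.theta_eq_log_primorial]
  · exact_mod_cast primorial_ne_zero _
  · exact_mod_cast primorial_ne_zero _

/-- **`d(n# · m#) = 2^{π(n) − π(m)} 3^{π(m)}`** for `m ≤ n`.
[cite: Nicolas2022HC, Prop. 3.10 (3.16) (log d(N)/log 2 = ∑ β_k π(ξ_k))] -/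
theorem card_divisors_primorial_mul {m n : ℕ} (hmn : m ≤ n) :
    (Nat.divisors (primorial n * primorial m)).card =
      2 ^ (Nat.primeCounting n - Nat.primeCounting m) * 3 ^ Nat.primeCounting m := by
  classical
  set P₁ := Nat.primesLE n with hP₁
  set P₂ := Nat.primesLE m with hP₂
  have hsub : P₂ ⊆ P₁ := Nat.primesLE_mono hmn
  set e : ℕ → ℕ := fun p ↦ if p ∈ P₂ then 2 else 1 with he
  -- `n# · m# = ∏_{P₁} p^{e p}`
  have hprod : primorial n * primorial m = ∏ p ∈ P₁, p ^ e p := by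
    have h1 : ∏ p ∈ P₁, p ^ e p = ∏ p ∈ P₁, (p * if p ∈ P₂ then p else 1) := by
      refine Finset.prod_congr rfl fun p _ ↦ ?_
      by_cases hp : p ∈ P₂
      · simp [he, hp, pow_two]
      · simp [he, hp]
    rw [h1, Finset.prod_mul_distrib, Finset.prod_ite_mem, Finset.inter_eq_right.2 hsub,
      primorial_eq_prod_primesLE, primorial_eq_prod_primesLE]
  -- multiplicativity of `σ₀`
  have hcop : (P₁ : Set ℕ).Pairwise (Function.onFun Nat.Coprime fun p ↦ p ^ e p) := by
    intro p hp q hq hpq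
    exact Nat.coprime_pow_primes _ _ (Nat.prime_of_mem_primesLE hp)
      (Nat.prime_of_mem_primesLE hq) hpq
  have hσ : (Nat.divisors (primorial n * primorial m)).card =
      ∏ p ∈ P₁, (e p + 1) := by
    rw [← ArithmeticFunction.sigma_zero_apply, hprod,
      ArithmeticFunction.isMultiplicative_sigma.map_prod _ P₁ hcop]
    refine Finset.prod_congr rfl fun p hp ↦ ?_
    exact ArithmeticFunction.sigma_zero_apply_prime_pow (Nat.prime_of_mem_primesLE hp)
  rw [hσ]
  have h2 : ∏ p ∈ P₁, (e p + 1) = ∏ p ∈ P₁, (if p ∈ P₂ then 3 else 2) := by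
    refine Finset.prod_congr rfl fun p _ ↦ ?_
    by_cases hp : p ∈ P₂ <;> simp [he, hp]
  rw [h2, Finset.prod_ite, Finset.prod_const, Finset.prod_const, Finset.filter_mem_eq_inter,
    Finset.inter_eq_right.2 hsub, Finset.filter_not, Finset.filter_mem_eq_inter,
    Finset.inter_eq_right.2 hsub, Finset.card_sdiff_of_subset hsub, hP₁, hP₂,
    Nat.primesLE_card_eq_primeCounting, Nat.primesLE_card_eq_primeCounting, mul_comm]

/-- `⌊ξ^{β₂}⌋₊ ≤ ⌊ξ⌋₊` for `ξ ≥ 1`. [folklore] -/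
private theorem floor_rpow_beta_le {ξ : ℝ} (hξ : 1 ≤ ξ) : ⌊ξ ^ beta 2⌋₊ ≤ ⌊ξ⌋₊ := by
  refine Nat.floor_le_floor ?_
  calc ξ ^ beta 2 ≤ ξ ^ (1 : ℝ) :=
        Real.rpow_le_rpow_of_exponent_le hξ (by linarith [beta_two_bounds.2])
    _ = ξ := Real.rpow_one ξ

/-- **`log d(N(ξ))/log 2 = π(ξ) + β₂ π(ξ^{β₂})`** (Nicolas's (3.36) with two levels).
[cite: Nicolas2022HC, Prop. 3.10 (3.16)] -/
theorem log2d_twoLevel {ξ : ℝ} (hξ : 1 ≤ ξ) :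
    log2d (twoLevel ξ) =
      (Nat.primeCounting ⌊ξ⌋₊ : ℝ) + beta 2 * Nat.primeCounting ⌊ξ ^ beta 2⌋₊ := by
  have hle := floor_rpow_beta_le hξ
  have hπle : Nat.primeCounting ⌊ξ ^ beta 2⌋₊ ≤ Nat.primeCounting ⌊ξ⌋₊ :=
    Nat.monotone_primeCounting hle
  have hl2 : 0 < Real.log 2 := Real.log_pos one_lt_two
  rw [log2d, twoLevel, card_divisors_primorial_mul hle]
  push_cast
  rw [Real.log_mul (by positivity) (by positivity), Real.log_pow, Real.log_pow, Nat.cast_sub hπle,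
    beta_two_eq]
  field_simp
  ring

/-! ### §7. Under RH: the two-level numbers satisfy (1.9) — tools -/

/-- `c log^k x ≤ x^a` eventually (`a > 0`). [folklore] -/
private theorem eventually_mul_log_pow_le_rpow (c : ℝ) (k : ℕ) {a : ℝ} (ha : 0 < a) :
    ∀ᶠ x : ℝ in atTop, c * Real.log x ^ k ≤ x ^ a := by
  have h1 : (fun x : ℝ ↦ Real.log x ^ (k : ℝ)) =o[atTop] fun x ↦ x ^ a :=
    isLittleO_log_rpow_rpow_atTop k ha
  have h2 := (h1.const_mul_left c).def one_pos
  filter_upwards [h2, eventually_gt_atTop 1] with x hx hx1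
  rw [Real.norm_eq_abs, Real.norm_eq_abs, one_mul, abs_of_nonneg (Real.rpow_nonneg (by linarith) _),
    Real.rpow_natCast] at hx
  exact (le_abs_self _).trans hx

/-- `|log u| ≤ 2|u − 1|` for `|u − 1| ≤ 1/2`. [folklore] -/
private theorem abs_log_le_two_mul {u : ℝ} (hu : |u - 1| ≤ 1 / 2) : |Real.log u| ≤ 2 * |u - 1| := by
  have hu1 := (abs_le.1 hu).1
  have hu2 := (abs_le.1 hu).2
  have hu0 : 0 < u := by linarith
  have h1 : Real.log u ≤ u - 1 := Real.log_le_sub_one_of_pos hu0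
  have h2 : 1 - 1 / u ≤ Real.log u := by
    have := Real.log_le_sub_one_of_pos (inv_pos.2 hu0)
    rw [Real.log_inv] at this
    rw [one_div]; linarith
  have h3 : -(2 * |u - 1|) ≤ 1 - 1 / u := by
    rw [one_div]
    have hu2' : 1 / 2 ≤ u := by linarith
    rcases le_or_gt 1 u with h | h
    · rw [abs_of_nonneg (by linarith)]
      have : u⁻¹ ≤ 1 := inv_le_one_of_one_le₀ h
      nlinarith
    · rw [abs_of_neg (by linarith)]
      have hinv : u⁻¹ ≤ 2 := by rw [inv_le_comm₀ hu0 two_pos]; linarith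
      have : 1 - u⁻¹ = (u - 1) * u⁻¹ := by field_simp
      rw [this]
      nlinarith [inv_pos.2 hu0]
  rw [abs_le]
  constructor <;> linarith [le_abs_self (u - 1)]

/-- **Von Koch control of `θ` under RH**, packaged: there are `K > 0` and `X > 1` with
`|θ(x) − x| ≤ K√x log² x ≤ x/4` for `x ≥ X`. [cite: Nicolas2022HC, §2.1 (2.8) (|θ(x) − x| ≤
√x log² x/(8π) for x ≥ 599 under RH, from Schoenfeld 1976 (6.3))] -/
theorem theta_control_of_RH (hRH : RiemannHypothesis) :
    ∃ K X : ℝ, 0 < K ∧ 1 < X ∧ ∀ x : ℝ, X ≤ x →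
      |θ x - x| ≤ K * Real.sqrt x * Real.log x ^ 2 ∧ K * Real.sqrt x * Real.log x ^ 2 ≤ x / 4 := by
  obtain ⟨K, X, hK, hX, hθ⟩ := exists_abs_theta_sub_le_of_RH hRH
  have hev := eventually_mul_log_pow_le_rpow (4 * K) 2 (by norm_num : (0 : ℝ) < 1 / 2)
  obtain ⟨X', hX'⟩ := Filter.eventually_atTop.1 hev
  refine ⟨K, max X (max X' 2), hK, by
    have : (2 : ℝ) ≤ max X (max X' 2) := (le_max_right _ _).trans' (le_max_right _ _)
    linarith, fun x hx ↦ ?_⟩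
  have hxX : X ≤ x := (le_max_left _ _).trans hx
  have hxX' : X' ≤ x := ((le_max_left _ _).trans (le_max_right _ _)).trans hx
  have hx0 : 0 < x := by linarith
  refine ⟨hθ x hxX, ?_⟩
  have h := hX' x hxX'
  rw [← Real.sqrt_eq_rpow] at h
  have hs : Real.sqrt x * Real.sqrt x = x := Real.mul_self_sqrt hx0.le
  have hs0 : 0 ≤ Real.sqrt x := Real.sqrt_nonneg x
  nlinarith [mul_le_mul_of_nonneg_left h hs0]

/-- Under RH, `A(y) ≤ 4√y/log² y` for `y ≥ Y`.
[cite: Nicolas2022HC, §2.5 (2.45) (A(x) ≤ 5.07√x/log²x under RH)] -/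
theorem exists_liThetaSubPi_le_of_RH (hRH : RiemannHypothesis) :
    ∃ Y : ℝ, 1 < Y ∧ ∀ y : ℝ, Y ≤ y → liThetaSubPi y ≤ 4 * Real.sqrt y / Real.log y ^ 2 := by
  have h := LiThetaLimsup.limsup_le hRH one_pos
  obtain ⟨Y, hY⟩ := Filter.eventually_atTop.1 h
  refine ⟨max Y 2, by linarith [le_max_right Y 2], fun y hy ↦ ?_⟩
  have hyY : Y ≤ y := (le_max_left _ _).trans hy
  have hy1 : 1 < y := by linarith [le_max_right Y 2]
  have hl : 0 < Real.log y := Real.log_pos hy1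
  have hs : 0 < Real.sqrt y := Real.sqrt_pos.2 (by linarith)
  have h1 := hY y hyY
  have hβ : nicolasBeta < 0.0474 := nicolasBeta_lt'
  rw [div_le_iff₀ hs] at h1
  rw [le_div_iff₀ (pow_pos hl 2)]
  nlinarith

/-- `N(ξ) → ∞`: beyond any bound (a prime `p > M` divides `⌊ξ⌋₊#` once `ξ ≥ p`). [folklore] -/
private theorem eventually_lt_twoLevel (M : ℕ) : ∀ᶠ ξ : ℝ in atTop, M < twoLevel ξ := by
  obtain ⟨p, hMp, hp⟩ := Nat.exists_infinite_primes (M + 1)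
  filter_upwards [eventually_ge_atTop (p : ℝ)] with ξ hξ
  have hfl : p ≤ ⌊ξ⌋₊ := Nat.le_floor hξ
  have hdvd : p ∣ primorial ⌊ξ⌋₊ := by
    rw [primorial_eq_prod_primesLE]
    exact Finset.dvd_prod_of_mem _ (Nat.mem_primesLE.2 ⟨hfl, hp⟩)
  have h1 : p ≤ primorial ⌊ξ⌋₊ := Nat.le_of_dvd (primorial_pos _) hdvd
  have h2 : primorial ⌊ξ⌋₊ ≤ twoLevel ξ := Nat.le_mul_of_pos_right _ (primorial_pos _)
  omega

/-- **Reduction**: if `(1.9)` holds at `N(ξ)` for all large `ξ`, then Theorem 1.1 (iii) holds.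
[cite: Nicolas2022HC, Thm. 1.1 (iii)] -/
theorem thm_1_1_iii_of_eventually (h : ∀ᶠ ξ : ℝ in atTop, Ineq19 (twoLevel ξ)) :
    Nicolas2022_thm_1_1_iii := by
  rw [Nicolas2022_thm_1_1_iii]
  refine Set.infinite_of_not_bddAbove ?_
  rintro ⟨M, hM⟩
  obtain ⟨ξ, hξ1, hξ2⟩ := (h.and (eventually_lt_twoLevel M)).exists
  exact absurd (hM hξ1) (not_le.2 hξ2)

/-! ### §8. Under RH: `(1.9)` at the two-level numbers, hence Theorem 1.1 (iii) -/

/-- `1/2 < β₂ < 3/5`. [cite: Nicolas2022HC, (1.2) (β₂ = log(3/2)/log 2 = 0.58496…)] -/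
theorem beta_two_bounds' : 1 / 2 < beta 2 ∧ beta 2 < 3 / 5 := by
  have hl2 : 0 < Real.log 2 := Real.log_pos one_lt_two
  have e : beta 2 = Real.log (3 / 2) / Real.log 2 := by rw [beta]; norm_num
  rw [e]
  constructor
  · rw [lt_div_iff₀ hl2]
    have h3 : Real.log (2 : ℝ) < Real.log ((3 / 2 : ℝ) ^ 2) :=
      Real.log_lt_log (by norm_num) (by norm_num)
    rw [Real.log_pow] at h3
    push_cast at h3
    linarith
  · rw [div_lt_iff₀ hl2]
    have h3 : Real.log ((3 / 2 : ℝ) ^ 5) < Real.log ((2 : ℝ) ^ 3) :=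
      Real.log_lt_log (by positivity) (by norm_num)
    rw [Real.log_pow, Real.log_pow] at h3
    push_cast at h3
    linarith

/-- Power bookkeeping for `y = ξ^{β₂}`, `ξ ≥ 1`: `√y ≤ ξ^{3/10}`, `y/√ξ ≤ ξ^{3/10}`,
`y²/ξ ≤ ξ^{3/10}` and `ξ^{3/10} ξ^{1/5} = √ξ`. [folklore] -/
private theorem rpow_beta_aux {ξ : ℝ} (hξ : 1 ≤ ξ) :
    Real.sqrt (ξ ^ beta 2) ≤ ξ ^ (3 / 10 : ℝ) ∧ ξ ^ beta 2 / Real.sqrt ξ ≤ ξ ^ (3 / 10 : ℝ) ∧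
      (ξ ^ beta 2) ^ 2 / ξ ≤ ξ ^ (3 / 10 : ℝ) ∧
      ξ ^ (3 / 10 : ℝ) * ξ ^ (1 / 5 : ℝ) = Real.sqrt ξ := by
  have hξ0 : 0 < ξ := by linarith
  obtain ⟨hb1, hb2⟩ := beta_two_bounds'
  refine ⟨?_, ?_, ?_, ?_⟩
  · rw [Real.sqrt_eq_rpow, ← Real.rpow_mul hξ0.le]
    exact Real.rpow_le_rpow_of_exponent_le hξ (by linarith)
  · rw [Real.sqrt_eq_rpow, ← Real.rpow_sub hξ0]
    exact Real.rpow_le_rpow_of_exponent_le hξ (by linarith)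
  · rw [← Real.rpow_natCast, ← Real.rpow_mul hξ0.le, ← Real.rpow_sub_one hξ0.ne']
    push_cast
    exact Real.rpow_le_rpow_of_exponent_le hξ (by linarith)
  · rw [← Real.rpow_add hξ0, Real.sqrt_eq_rpow]
    norm_num

/-- **Under RH, `A(ξ) − R(ξ) ≤ 9.2 √ξ/log³ ξ` for large `ξ`.**
[cite: Nicolas2022HC, Prop. 2.12 (2.53) (A ≤ R + 25.3√x/log³x under RH)] -/
theorem liThetaSubPi_sub_R_le_of_RH (hRH : RiemannHypothesis) :
    ∀ᶠ ξ : ℝ in atTop, liThetaSubPi ξ - R ξ ≤ 9.2 * (Real.sqrt ξ / Real.log ξ ^ 3) := by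
  have hβ := nicolasBeta_lt'
  filter_upwards [prop_2_12_of_RH hRH one_pos, eventually_gt_atTop 1] with ξ h hξ
  have hW : 0 ≤ Real.sqrt ξ / Real.log ξ ^ 3 :=
    div_nonneg (Real.sqrt_nonneg _) (pow_nonneg (Real.log_pos hξ).le _)
  have h1 := (abs_le.1 h).2
  have e : 8 * Real.sqrt ξ / Real.log ξ ^ 3 = 8 * (Real.sqrt ξ / Real.log ξ ^ 3) := by ring
  rw [e] at h1
  nlinarith

/-- **Under RH, `β₂ A(ξ^{β₂}) ≤ √ξ/log³ ξ` for large `ξ`** (the second level costs nothing at the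
`√ξ/log³ξ` scale). [cite: Nicolas2022HC, §2.5 (2.45) and §4.1 (4.6)] -/
theorem beta_mul_liThetaSubPi_le_of_RH (hRH : RiemannHypothesis) :
    ∀ᶠ ξ : ℝ in atTop, beta 2 * liThetaSubPi (ξ ^ beta 2) ≤ Real.sqrt ξ / Real.log ξ ^ 3 := by
  obtain ⟨Y, hY1, hY⟩ := exists_liThetaSubPi_le_of_RH hRH
  obtain ⟨hb0, hb34⟩ := beta_two_bounds
  obtain ⟨hb1, hb2⟩ := beta_two_bounds'
  filter_upwards [(tendsto_rpow_atTop hb0).eventually_ge_atTop Y, eventually_ge_atTop (3 : ℝ),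
    eventually_mul_log_pow_le_rpow 16 1 (by norm_num : (0 : ℝ) < 1 / 5)] with ξ hyY hξ3 hsm
  have hξ1 : 1 ≤ ξ := by linarith
  have hξ0 : 0 < ξ := by linarith
  have hl : 1 ≤ Real.log ξ := by
    rw [Real.le_log_iff_exp_le hξ0]
    linarith [Real.exp_one_lt_d9]
  have hl0 : 0 < Real.log ξ := by linarith
  have hly : Real.log (ξ ^ beta 2) = beta 2 * Real.log ξ := Real.log_rpow hξ0 _
  have hly0 : 0 < Real.log (ξ ^ beta 2) := by rw [hly]; positivity
  have hA := hY _ hyY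
  obtain ⟨h1, -, -, h4⟩ := rpow_beta_aux hξ1
  have hbound : 4 * Real.sqrt (ξ ^ beta 2) / Real.log (ξ ^ beta 2) ^ 2 ≤
      Real.sqrt ξ / Real.log ξ ^ 3 := by
    rw [div_le_div_iff₀ (pow_pos hly0 2) (pow_pos hl0 3)]
    have hly2 : Real.log ξ ^ 2 / 4 ≤ Real.log (ξ ^ beta 2) ^ 2 := by
      rw [hly]
      have h12 : Real.log ξ / 2 ≤ beta 2 * Real.log ξ := by nlinarith
      calc Real.log ξ ^ 2 / 4 = (Real.log ξ / 2) ^ 2 := by ring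
        _ ≤ _ := pow_le_pow_left₀ (by positivity) h12 2
    rw [pow_one] at hsm
    calc 4 * Real.sqrt (ξ ^ beta 2) * Real.log ξ ^ 3
        ≤ 4 * ξ ^ (3 / 10 : ℝ) * Real.log ξ ^ 3 := by gcongr
      _ = ξ ^ (3 / 10 : ℝ) * (16 * Real.log ξ) * (Real.log ξ ^ 2 / 4) := by ring
      _ ≤ ξ ^ (3 / 10 : ℝ) * ξ ^ (1 / 5 : ℝ) * Real.log (ξ ^ beta 2) ^ 2 := by gcongr
      _ = Real.sqrt ξ * Real.log (ξ ^ beta 2) ^ 2 := by rw [h4]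
  have hW : 0 ≤ Real.sqrt ξ / Real.log ξ ^ 3 := by positivity
  rcases le_or_gt 0 (liThetaSubPi (ξ ^ beta 2)) with hA0 | hA0
  · calc beta 2 * liThetaSubPi (ξ ^ beta 2) ≤ 1 * liThetaSubPi (ξ ^ beta 2) := by gcongr; linarith
      _ ≤ _ := by rw [one_mul]; exact hA.trans hbound
  · nlinarith

/-- Comparison of the error scales: for `ξ ≥ e³²` and `3ξ/4 ≤ L ≤ 3ξ/2`,
`12.2 √ξ/log³ ξ ≤ 25.3 √L/log³ L`. [folklore] -/
private theorem err_scale_cmp {ξ L : ℝ} (hξ : Real.exp 32 ≤ ξ) (hL1 : 3 * ξ / 4 ≤ L)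
    (hL2 : L ≤ 3 * ξ / 2) :
    12.2 * (Real.sqrt ξ / Real.log ξ ^ 3) ≤ 25.3 * Real.sqrt L / Real.log L ^ 3 := by
  have hξ0 : 0 < ξ := (Real.exp_pos 32).trans_le hξ
  have hl : 32 ≤ Real.log ξ := by rw [Real.le_log_iff_exp_le hξ0]; exact hξ
  have hl0 : 0 < Real.log ξ := by linarith
  have hL0 : 0 < L := by linarith
  have he1 : (5 : ℝ) ≤ Real.exp 4 := by linarith [Real.add_one_le_exp (4 : ℝ)]
  have he32 : (5 : ℝ) ≤ Real.exp 32 := he1.trans (Real.exp_le_exp.2 (by norm_num))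
  have hL1' : 1 < L := by linarith
  have hlL0 : 0 < Real.log L := Real.log_pos hL1'
  -- `√L ≥ 0.86 √ξ`
  have hsL : 0.86 * Real.sqrt ξ ≤ Real.sqrt L := by
    have e : 0.86 * Real.sqrt ξ = Real.sqrt ((0.86 : ℝ) ^ 2 * ξ) := by
      rw [Real.sqrt_mul' _ hξ0.le, Real.sqrt_sq (by norm_num)]
    rw [e]
    exact Real.sqrt_le_sqrt (by nlinarith)
  -- `log L ≤ ℓ + 1`
  have hlL : Real.log L ≤ Real.log ξ + 1 := by
    have h2 : L ≤ ξ * Real.exp 1 := by nlinarith [Real.add_one_le_exp (1 : ℝ)]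
    calc Real.log L ≤ Real.log (ξ * Real.exp 1) := Real.log_le_log hL0 h2
      _ = Real.log ξ + 1 := by rw [Real.log_mul hξ0.ne' (Real.exp_pos 1).ne', Real.log_exp]
  -- `(ℓ + 1)³ ≤ 1.1 ℓ³`
  have hcube : Real.log L ^ 3 ≤ 1.1 * Real.log ξ ^ 3 := by
    have h1 : 32 * Real.log ξ ^ 2 ≤ Real.log ξ ^ 3 := by nlinarith
    have h2 : 32 * Real.log ξ ≤ Real.log ξ ^ 2 := by nlinarith
    calc Real.log L ^ 3 ≤ (Real.log ξ + 1) ^ 3 := by gcongr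
      _ ≤ 1.1 * Real.log ξ ^ 3 := by nlinarith
  rw [mul_div_assoc', div_le_div_iff₀ (pow_pos hl0 3) (pow_pos hlL0 3)]
  have hs0 : 0 ≤ Real.sqrt ξ := Real.sqrt_nonneg ξ
  calc 12.2 * Real.sqrt ξ * Real.log L ^ 3
      ≤ 12.2 * Real.sqrt ξ * (1.1 * Real.log ξ ^ 3) := by gcongr
    _ ≤ 25.3 * (0.86 * Real.sqrt ξ) * Real.log ξ ^ 3 := by nlinarith [pow_pos hl0 3]
    _ ≤ 25.3 * Real.sqrt L * Real.log ξ ^ 3 := by gcongr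

/-- **Two-level set-up under RH.** There are `K > 0`, `X > 1` such that for `ξ ≥ X`, with
`y = ξ^{β₂}`, `T = θ(ξ)`, `U = θ(y)`, `L = T + U`, `ℓ = log ξ`: `ℓ ≥ 32`, `5y ≤ ξ`,
`|T − ξ| ≤ K√ξ ℓ² ≤ ξ/4`, `|U − y| ≤ K√y log²y ≤ y/4`, `log T ≥ ℓ/2`, `log U ≥ β₂ℓ/2`,
`ℓ/2 ≤ log L ≤ ℓ + 1/2`. [cite: Nicolas2022HC, Lemma 3.18 (3.33)–(3.35) with §2.1 (2.8)] -/
theorem twoLevel_setup_of_RH (hRH : RiemannHypothesis) :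
    ∃ K X : ℝ, 0 < K ∧ 1 < X ∧ ∀ ξ : ℝ, X ≤ ξ →
      32 ≤ Real.log ξ ∧ 5 * ξ ^ beta 2 ≤ ξ ∧
      |θ ξ - ξ| ≤ K * Real.sqrt ξ * Real.log ξ ^ 2 ∧ K * Real.sqrt ξ * Real.log ξ ^ 2 ≤ ξ / 4 ∧
      |θ (ξ ^ beta 2) - ξ ^ beta 2| ≤
          K * Real.sqrt (ξ ^ beta 2) * Real.log (ξ ^ beta 2) ^ 2 ∧
      K * Real.sqrt (ξ ^ beta 2) * Real.log (ξ ^ beta 2) ^ 2 ≤ ξ ^ beta 2 / 4 ∧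
      Real.log ξ / 2 ≤ Real.log (θ ξ) ∧
      beta 2 * Real.log ξ / 2 ≤ Real.log (θ (ξ ^ beta 2)) ∧
      Real.log ξ / 2 ≤ Real.log (θ ξ + θ (ξ ^ beta 2)) ∧
      Real.log (θ ξ + θ (ξ ^ beta 2)) ≤ Real.log ξ + 1 / 2 := by
  obtain ⟨K, X, hK, hX1, hθ⟩ := theta_control_of_RH hRH
  obtain ⟨hb0, hb34⟩ := beta_two_bounds
  have hev : ∀ᶠ ξ : ℝ in atTop,
      X ≤ ξ ∧ X ≤ ξ ^ beta 2 ∧ Real.exp 32 ≤ ξ ∧ 5 ≤ ξ ^ (1 - beta 2) :=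
    (eventually_ge_atTop X).and (((tendsto_rpow_atTop hb0).eventually_ge_atTop X).and
      ((eventually_ge_atTop _).and
        ((tendsto_rpow_atTop (by linarith : 0 < 1 - beta 2)).eventually_ge_atTop _)))
  obtain ⟨X₁, hX₁⟩ := Filter.eventually_atTop.1 hev
  refine ⟨K, max X₁ 2, hK, by linarith [le_max_right X₁ 2], fun ξ hξ ↦ ?_⟩
  obtain ⟨hξX, hyX, hξe, hξ5⟩ := hX₁ ξ ((le_max_left _ _).trans hξ)
  have hξ0 : 0 < ξ := by linarith [le_max_right X₁ 2]
  have hy0 : 0 < ξ ^ beta 2 := Real.rpow_pos_of_pos hξ0 _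
  have hl : 32 ≤ Real.log ξ := by rw [Real.le_log_iff_exp_le hξ0]; exact hξe
  have hly : Real.log (ξ ^ beta 2) = beta 2 * Real.log ξ := Real.log_rpow hξ0 _
  have hy5 : 5 * ξ ^ beta 2 ≤ ξ := by
    have e : ξ ^ (1 - beta 2) * ξ ^ beta 2 = ξ := by
      rw [← Real.rpow_add hξ0]; norm_num
    calc 5 * ξ ^ beta 2 ≤ ξ ^ (1 - beta 2) * ξ ^ beta 2 := by gcongr
      _ = ξ := e
  obtain ⟨hT1, hT2⟩ := hθ ξ hξX
  obtain ⟨hU1, hU2⟩ := hθ _ hyX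
  have hTlo : 3 * ξ / 4 ≤ θ ξ := by have := (abs_le.1 hT1).1; linarith
  have hThi : θ ξ ≤ 5 * ξ / 4 := by have := (abs_le.1 hT1).2; linarith
  have hUlo : 3 * ξ ^ beta 2 / 4 ≤ θ (ξ ^ beta 2) := by have := (abs_le.1 hU1).1; linarith
  have hUhi : θ (ξ ^ beta 2) ≤ 5 * ξ ^ beta 2 / 4 := by have := (abs_le.1 hU1).2; linarith
  have hT0 : 0 < θ ξ := by linarith
  have h34 : -(1 / 3) ≤ Real.log (3 / 4 : ℝ) := by
    have := Real.log_le_sub_one_of_pos (show (0 : ℝ) < 4 / 3 by norm_num)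
    rw [show (3 / 4 : ℝ) = (4 / 3)⁻¹ by norm_num, Real.log_inv]
    linarith
  have h32 : Real.log (3 / 2 : ℝ) ≤ 1 / 2 := by
    have := Real.log_le_sub_one_of_pos (show (0 : ℝ) < 3 / 2 by norm_num)
    linarith
  have hlogT : Real.log ξ / 2 ≤ Real.log (θ ξ) := by
    have h1 : Real.log (ξ * (3 / 4)) ≤ Real.log (θ ξ) :=
      Real.log_le_log (by positivity) (by linarith)
    rw [Real.log_mul hξ0.ne' (by norm_num)] at h1
    linarith
  have hlogU : beta 2 * Real.log ξ / 2 ≤ Real.log (θ (ξ ^ beta 2)) := by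
    have h1 : Real.log (ξ ^ beta 2 * (3 / 4)) ≤ Real.log (θ (ξ ^ beta 2)) :=
      Real.log_le_log (by positivity) (by linarith)
    rw [Real.log_mul hy0.ne' (by norm_num), hly] at h1
    have : 16 ≤ beta 2 * Real.log ξ := by nlinarith [beta_two_bounds'.1]
    linarith
  have hlogL1 : Real.log ξ / 2 ≤ Real.log (θ ξ + θ (ξ ^ beta 2)) :=
    hlogT.trans (Real.log_le_log hT0 (by linarith))
  have hlogL2 : Real.log (θ ξ + θ (ξ ^ beta 2)) ≤ Real.log ξ + 1 / 2 := by
    have h1 : Real.log (θ ξ + θ (ξ ^ beta 2)) ≤ Real.log (ξ * (3 / 2)) :=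
      Real.log_le_log (by linarith) (by linarith)
    rw [Real.log_mul hξ0.ne' (by norm_num)] at h1
    linarith
  exact ⟨hl, hy5, hT1, hT2, hU1, hU2, hlogT, hlogU, hlogL1, hlogL2⟩

/-- Logarithms at the level `L ∈ [3ξ/4, 3ξ/2]`, `ξ ≥ e⁴`: `ℓ/2 ≤ log L ≤ ℓ + 1/2`,
`|log L − ℓ| ≤ 2|ξ − L|/ξ ≤ 1`. [folklore] -/
private theorem log_level_bounds {ξ L : ℝ} (hξe : Real.exp 4 ≤ ξ) (hL1 : 3 * ξ / 4 ≤ L)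
    (hL2 : L ≤ 3 * ξ / 2) :
    Real.log ξ / 2 ≤ Real.log L ∧ Real.log L ≤ Real.log ξ + 1 / 2 ∧
      |Real.log L - Real.log ξ| ≤ 2 * |ξ - L| / ξ ∧ |Real.log L - Real.log ξ| ≤ 1 := by
  have hξ0 : 0 < ξ := (Real.exp_pos 4).trans_le hξe
  have hl4 : 4 ≤ Real.log ξ := by rw [Real.le_log_iff_exp_le hξ0]; exact hξe
  have hL0 : 0 < L := by linarith
  have h34 : -(1 / 3) ≤ Real.log (3 / 4 : ℝ) := by
    have := Real.log_le_sub_one_of_pos (show (0 : ℝ) < 4 / 3 by norm_num)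
    rw [show (3 / 4 : ℝ) = (4 / 3)⁻¹ by norm_num, Real.log_inv]
    linarith
  have h32 : Real.log (3 / 2 : ℝ) ≤ 1 / 2 := by
    have := Real.log_le_sub_one_of_pos (show (0 : ℝ) < 3 / 2 by norm_num)
    linarith
  have hlogL1 : Real.log ξ / 2 ≤ Real.log L := by
    have h1 : Real.log (ξ * (3 / 4)) ≤ Real.log L := Real.log_le_log (by positivity) (by linarith)
    rw [Real.log_mul hξ0.ne' (by norm_num)] at h1
    linarith
  have hlogL2 : Real.log L ≤ Real.log ξ + 1 / 2 := by
    have h1 : Real.log L ≤ Real.log (ξ * (3 / 2)) := Real.log_le_log hL0 (by linarith)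
    rw [Real.log_mul hξ0.ne' (by norm_num)] at h1
    linarith
  have hLξ : |L / ξ - 1| = |ξ - L| / ξ := by
    rw [show L / ξ - 1 = (L - ξ) / ξ by field_simp, abs_div, abs_of_pos hξ0, abs_sub_comm]
  have hq : |ξ - L| / ξ ≤ 1 / 2 := by
    rw [div_le_iff₀ hξ0, abs_le]; constructor <;> linarith
  have hlogdiff : |Real.log L - Real.log ξ| ≤ 2 * |ξ - L| / ξ := by
    have := abs_log_le_two_mul (u := L / ξ) (by rw [hLξ]; exact hq)
    rw [Real.log_div hL0.ne' hξ0.ne', hLξ] at this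
    rw [mul_div_assoc]; exact this
  refine ⟨hlogL1, hlogL2, hlogdiff, hlogdiff.trans ?_⟩
  rw [mul_div_assoc]
  linarith

/-- `|√ξ − √L| ≤ |ξ − L|/√ξ` (`ξ > 0`, `L ≥ 0`). [folklore] -/
private theorem abs_sqrt_sub_sqrt_le {ξ L : ℝ} (hξ : 0 < ξ) (hL : 0 ≤ L) :
    |Real.sqrt ξ - Real.sqrt L| ≤ |ξ - L| / Real.sqrt ξ := by
  have hsξ : 0 < Real.sqrt ξ := Real.sqrt_pos.2 hξ
  have hsL : 0 ≤ Real.sqrt L := Real.sqrt_nonneg L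
  have hsq : Real.sqrt ξ * Real.sqrt ξ = ξ := Real.mul_self_sqrt hξ.le
  have hsqL : Real.sqrt L * Real.sqrt L = L := Real.mul_self_sqrt hL
  have hprod : |Real.sqrt ξ - Real.sqrt L| * (Real.sqrt ξ + Real.sqrt L) = |ξ - L| := by
    rw [← abs_of_pos (by positivity : 0 < Real.sqrt ξ + Real.sqrt L), ← abs_mul]
    congr 1
    linear_combination hsq - hsqL
  rw [le_div_iff₀ hsξ, ← hprod]
  gcongr
  linarith

/-- Under the RH control `|θ(t) − t| ≤ K√t log²t`: `|1 − ψ(t)/t| ≤ 8(K+2) log²ξ/√ξ` for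
`t ∈ [3ξ/4, 3ξ/2]`, `ξ ≥ e⁴` (with `ψ − θ ≤ 2√t log t`). [folklore] -/
private theorem abs_one_sub_psi_div_le {K ξ t : ℝ} (hK : 0 ≤ K) (hξe : Real.exp 4 ≤ ξ)
    (ht1 : 3 * ξ / 4 ≤ t) (ht2 : t ≤ 3 * ξ / 2)
    (hθt : |θ t - t| ≤ K * Real.sqrt t * Real.log t ^ 2) :
    |1 - ψ t / t| ≤ 8 * (K + 2) * Real.log ξ ^ 2 / Real.sqrt ξ := by
  have hξ0 : 0 < ξ := (Real.exp_pos 4).trans_le hξe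
  have hl4 : 4 ≤ Real.log ξ := by rw [Real.le_log_iff_exp_le hξ0]; exact hξe
  have he4 : (5 : ℝ) ≤ Real.exp 4 := by linarith [Real.add_one_le_exp (4 : ℝ)]
  have ht0 : 0 < t := by linarith
  have ht1' : 1 ≤ t := by linarith
  have hsξ : 0 < Real.sqrt ξ := Real.sqrt_pos.2 hξ0
  have hsqt : Real.sqrt t * Real.sqrt t = t := Real.mul_self_sqrt ht0.le
  have hψθ := Chebyshev.psi_sub_theta_le ht1'
  have hθψ := Chebyshev.theta_le_psi t
  have hlt1 : 1 ≤ Real.log t := by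
    rw [Real.le_log_iff_exp_le ht0]
    linarith [Real.exp_one_lt_d9]
  have hlt2 : Real.log t ≤ 2 * Real.log ξ := by
    have h32 : Real.log (3 / 2 : ℝ) ≤ 1 / 2 := by
      have := Real.log_le_sub_one_of_pos (show (0 : ℝ) < 3 / 2 by norm_num)
      linarith
    have h1 : Real.log t ≤ Real.log (ξ * (3 / 2)) := Real.log_le_log ht0 (by linarith)
    rw [Real.log_mul hξ0.ne' (by norm_num)] at h1
    linarith
  have hlt0 : 0 ≤ Real.log t := by linarith
  have hsx : Real.sqrt ξ ≤ 2 * Real.sqrt t := by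
    have e : 2 * Real.sqrt t = Real.sqrt ((2 : ℝ) ^ 2 * t) := by
      rw [Real.sqrt_mul' _ ht0.le, Real.sqrt_sq (by norm_num)]
    rw [e]
    exact Real.sqrt_le_sqrt (by linarith)
  have hψt : |ψ t - t| ≤ (K + 2) * Real.sqrt t * Real.log t ^ 2 := by
    have e : ψ t - t = (ψ t - θ t) + (θ t - t) := by ring
    rw [e]
    refine (abs_add_le _ _).trans ?_
    rw [abs_of_nonneg (by linarith)]
    have h2 : 2 * Real.sqrt t * Real.log t ≤ 2 * Real.sqrt t * Real.log t ^ 2 := by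
      have : Real.log t ≤ Real.log t ^ 2 := by nlinarith
      gcongr
    nlinarith
  have e1 : 1 - ψ t / t = (t - ψ t) / t := by field_simp
  rw [e1, abs_div, abs_of_pos ht0, abs_sub_comm, div_le_iff₀ ht0, div_mul_eq_mul_div,
    le_div_iff₀ hsξ]
  calc |ψ t - t| * Real.sqrt ξ ≤ (K + 2) * Real.sqrt t * Real.log t ^ 2 * Real.sqrt ξ := by
        gcongr
    _ = (K + 2) * Real.sqrt t * (Real.log t ^ 2 * Real.sqrt ξ) := by ring
    _ ≤ (K + 2) * Real.sqrt t * ((2 * Real.log ξ) ^ 2 * (2 * Real.sqrt t)) := by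
        gcongr (K + 2) * Real.sqrt t * ?_
        exact mul_le_mul (pow_le_pow_left₀ hlt0 hlt2 2) hsx hsξ.le (by positivity)
    _ = 8 * (K + 2) * Real.log ξ ^ 2 * (Real.sqrt t * Real.sqrt t) := by ring
    _ = 8 * (K + 2) * Real.log ξ ^ 2 * t := by rw [hsqt]

/-- The algebra of `R(ξ) − R(L)`. [folklore] -/
private theorem R_sub_R_eq {ξ L : ℝ} (hlξ : Real.log ξ ≠ 0) (hlL : Real.log L ≠ 0) :
    R ξ - R L =
      ((2 * Real.sqrt ξ + (S ξ).re) - (2 * Real.sqrt L + (S L).re)) / Real.log L ^ 2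
        + (2 * Real.sqrt ξ + (S ξ).re) * (Real.log L ^ 2 - Real.log ξ ^ 2)
          / (Real.log ξ ^ 2 * Real.log L ^ 2) := by
  rw [R, R]
  field_simp
  ring

/-- **`R` is slowly varying (under RH).** There are `C`, `Ξ` with
`|R(ξ) − R(L)| ≤ C (|ξ − L|/√ξ + 1)` whenever `ξ ≥ Ξ` and `3ξ/4 ≤ L ≤ 3ξ/2` — from Lemma 2.5:
`S = I − log(2π) log + c₀ + O(1)` with `I′(t) = 1 − ψ(t)/t = O(log² t/√t)` under RH.
[cite: Nicolas2022HC, Lemma 2.5 (2.19) with (1.5)–(1.6)] -/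
theorem abs_R_sub_R_le_of_RH (hRH : RiemannHypothesis) :
    ∃ C Ξ : ℝ, 0 < C ∧ 1 < Ξ ∧ ∀ ξ L : ℝ, Ξ ≤ ξ → 3 * ξ / 4 ≤ L → L ≤ 3 * ξ / 2 →
      |R ξ - R L| ≤ C * (|ξ - L| / Real.sqrt ξ + 1) := by
  obtain ⟨K, X, hK, hX1, hθ⟩ := theta_control_of_RH hRH
  obtain ⟨K₁, hK₁, hE⟩ := exists_abs_sErr_le
  have hlam := nicolasBeta_lt'
  have hc₂0 : 0 ≤ Real.log (2 * π) := Real.log_nonneg (by linarith [Real.pi_gt_three])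
  have he4 : (5 : ℝ) ≤ Real.exp 4 := by linarith [Real.add_one_le_exp (4 : ℝ)]
  refine ⟨8 + 32 * (K + 2) + 72 + 4 * (Real.log (2 * π) + 2 * K₁), max (4 * X / 3) (Real.exp 4),
    by positivity, by linarith [le_max_right (4 * X / 3) (Real.exp 4)],
    fun ξ L hξ hL1 hL2 ↦ ?_⟩
  have hξX : 4 * X / 3 ≤ ξ := (le_max_left _ _).trans hξ
  have hξe : Real.exp 4 ≤ ξ := (le_max_right _ _).trans hξ
  have hξ0 : 0 < ξ := by linarith
  have hl4 : 4 ≤ Real.log ξ := by rw [Real.le_log_iff_exp_le hξ0]; exact hξe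
  have hl0 : 0 < Real.log ξ := by linarith
  have hL0 : 0 < L := by linarith
  have hξ1 : 1 ≤ ξ := by linarith
  have hL1' : 1 ≤ L := by linarith
  have hsξ : 0 < Real.sqrt ξ := Real.sqrt_pos.2 hξ0
  obtain ⟨hlogL1, hlogL2, hlogdiff, hlogdiff1⟩ := log_level_bounds hξe hL1 hL2
  have hlogL0 : 0 < Real.log L := by linarith
  -- `|I(ξ) − I(L)| ≤ M |ξ − L|`
  have hMt : ∀ t ∈ Icc (min ξ L) (max ξ L),
      |1 - ψ t / t| ≤ 8 * (K + 2) * Real.log ξ ^ 2 / Real.sqrt ξ := by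
    intro t ht
    have ht1 : 3 * ξ / 4 ≤ t := le_trans (le_min (by linarith) hL1) ht.1
    have ht2 : t ≤ 3 * ξ / 2 := ht.2.trans (max_le (by linarith) hL2)
    exact abs_one_sub_psi_div_le hK.le hξe ht1 ht2 (hθ t (by linarith)).1
  have hI : |primeIntegral ξ - primeIntegral L| ≤
      8 * (K + 2) * Real.log ξ ^ 2 / Real.sqrt ξ * |ξ - L| := by
    rcases le_total ξ L with h | h
    · rw [abs_sub_comm, abs_of_nonpos (by linarith : ξ - L ≤ 0), neg_sub]
      refine abs_primeIntegral_sub_le hξ1 h fun t ht ↦ hMt t ?_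
      rwa [min_eq_left h, max_eq_right h]
    · rw [abs_of_nonneg (by linarith : 0 ≤ ξ - L)]
      refine abs_primeIntegral_sub_le hL1' h fun t ht ↦ hMt t ?_
      rwa [min_eq_right h, max_eq_left h]
  have hsqrt := abs_sqrt_sub_sqrt_le hξ0 hL0.le
  -- the `S` difference via Lemma 2.5
  have hSdiff : (S ξ).re - (S L).re = (primeIntegral ξ - primeIntegral L)
      - Real.log (2 * π) * (Real.log ξ - Real.log L) + (sErr ξ - sErr L) := by
    rw [re_S_eq hξ1, re_S_eq hL1']; ring
  have hEξ := hE ξ hξ1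
  have hEL := hE L hL1'
  set D := |ξ - L| / Real.sqrt ξ with hD
  have hD0 : 0 ≤ D := by positivity
  have e2 : 8 * (K + 2) * Real.log ξ ^ 2 / Real.sqrt ξ * |ξ - L| =
      8 * (K + 2) * Real.log ξ ^ 2 * D := by
    rw [hD]; ring
  rw [e2] at hI
  -- numerator difference
  have hac : |(2 * Real.sqrt ξ + (S ξ).re) - (2 * Real.sqrt L + (S L).re)| ≤
      2 * D + (8 * (K + 2) * Real.log ξ ^ 2 * D + Real.log (2 * π) * 1 + (K₁ + K₁)) := by
    have e : (2 * Real.sqrt ξ + (S ξ).re) - (2 * Real.sqrt L + (S L).re) =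
        2 * (Real.sqrt ξ - Real.sqrt L) + ((primeIntegral ξ - primeIntegral L)
          + -(Real.log (2 * π) * (Real.log ξ - Real.log L)) + (sErr ξ - sErr L)) := by
      rw [show (S ξ).re = (S ξ).re - (S L).re + (S L).re by ring, hSdiff]; ring
    rw [e]
    refine (abs_add_le _ _).trans (add_le_add ?_ ?_)
    · rw [abs_mul, abs_two]
      exact mul_le_mul_of_nonneg_left hsqrt zero_le_two
    · refine (abs_add_le _ _).trans (add_le_add ((abs_add_le _ _).trans (add_le_add hI ?_)) ?_)
      · rw [abs_neg, abs_mul, abs_of_nonneg hc₂0, abs_sub_comm]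
        exact mul_le_mul_of_nonneg_left hlogdiff1 hc₂0
      · exact (abs_sub _ _).trans (add_le_add hEξ hEL)
  -- `|a| ≤ 3√ξ`
  have ha : |2 * Real.sqrt ξ + (S ξ).re| ≤ 3 * Real.sqrt ξ := by
    refine (abs_add_le _ _).trans ?_
    rw [abs_of_nonneg (by positivity : (0:ℝ) ≤ 2 * Real.sqrt ξ)]
    have h1 := abs_re_S_le_of_RH hRH hξ0
    have h2 : nicolasBeta * Real.sqrt ξ ≤ 1 * Real.sqrt ξ :=
      mul_le_mul_of_nonneg_right (by linarith) hsξ.le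
    linarith
  -- `|log²L − log²ξ| ≤ 6 ℓ |ξ − L|/ξ`
  have hqp : |Real.log L ^ 2 - Real.log ξ ^ 2| ≤ 3 * Real.log ξ * (2 * |ξ - L| / ξ) := by
    rw [sq_sub_sq, abs_mul, abs_of_pos (by linarith : 0 < Real.log L + Real.log ξ)]
    exact mul_le_mul (by linarith) hlogdiff (abs_nonneg _) (by linarith)
  have hq4 : Real.log ξ ^ 2 / 4 ≤ Real.log L ^ 2 := by
    calc Real.log ξ ^ 2 / 4 = (Real.log ξ / 2) ^ 2 := by ring
      _ ≤ Real.log L ^ 2 := pow_le_pow_left₀ (by positivity) hlogL1 2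
  rw [R_sub_R_eq hl0.ne' hlogL0.ne']
  -- first piece
  have h1 : |((2 * Real.sqrt ξ + (S ξ).re) - (2 * Real.sqrt L + (S L).re)) / Real.log L ^ 2|
      ≤ (8 + 32 * (K + 2)) * D + 4 * (Real.log (2 * π) + 2 * K₁) := by
    rw [abs_div, abs_of_pos (by positivity : 0 < Real.log L ^ 2), div_le_iff₀ (by positivity)]
    refine hac.trans ?_
    have hl1 : 1 ≤ Real.log ξ ^ 2 := by nlinarith
    have hA0 : 0 ≤ (8 + 32 * (K + 2)) * D + 4 * (Real.log (2 * π) + 2 * K₁) := by positivity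
    have hm1 := mul_le_mul_of_nonneg_left hq4 hA0
    have hm2 : 0 ≤ (Real.log ξ ^ 2 - 1) * D := mul_nonneg (by linarith) hD0
    have hm3 : 0 ≤ (Real.log ξ ^ 2 - 1) * (Real.log (2 * π) + 2 * K₁) :=
      mul_nonneg (by linarith) (by positivity)
    have hm4 : 0 ≤ K * (Real.log ξ ^ 2 * D) := mul_nonneg hK.le (by positivity)
    linarith
  -- second piece
  have h2 : |(2 * Real.sqrt ξ + (S ξ).re) * (Real.log L ^ 2 - Real.log ξ ^ 2)
      / (Real.log ξ ^ 2 * Real.log L ^ 2)| ≤ 72 * D := by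
    rw [abs_div, abs_of_pos (by positivity : 0 < Real.log ξ ^ 2 * Real.log L ^ 2),
      div_le_iff₀ (by positivity), abs_mul]
    calc |2 * Real.sqrt ξ + (S ξ).re| * |Real.log L ^ 2 - Real.log ξ ^ 2|
        ≤ 3 * Real.sqrt ξ * (3 * Real.log ξ * (2 * |ξ - L| / ξ)) :=
          mul_le_mul ha hqp (abs_nonneg _) (by positivity)
      _ = 18 * Real.log ξ * |ξ - L| * (Real.sqrt ξ / ξ) := by ring
      _ = 18 * Real.log ξ * |ξ - L| * (1 / Real.sqrt ξ) := by rw [Real.sqrt_div_self']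
      _ = 18 * Real.log ξ * D := by rw [hD]; ring
      _ ≤ 72 * D * (Real.log ξ ^ 2 * Real.log L ^ 2) := by
          have hm := mul_le_mul_of_nonneg_left hq4
            (by positivity : 0 ≤ 72 * D * Real.log ξ ^ 2)
          have h13 : 1 ≤ Real.log ξ ^ 3 := one_le_pow₀ (by linarith)
          have h14 : 0 ≤ (Real.log ξ ^ 3 - 1) * (Real.log ξ * D) :=
            mul_nonneg (sub_nonneg.2 h13) (by positivity)
          linarith
  refine (abs_add_le _ _).trans ?_
  have hx : 0 ≤ (Real.log (2 * π) + 2 * K₁) * D := by positivity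
  linarith [h1, h2, hx, hK.le]

/-- First `li` term at two levels: `U (log L − log T)/(log T log L) ≤ (25/3) ξ^{3/10}`
(`log L − log T ≤ U/T`, `U ≤ 5y/4`, `T ≥ 3ξ/4`, `y²/ξ ≤ ξ^{3/10}`). [folklore] -/
private theorem li_term1_le {ξ y T U L : ℝ} (hξ0 : 0 < ξ) (hy0 : 0 < y) (hT0 : 0 < T)
    (hU0 : 0 < U) (hL : L = T + U) (hTlo : 3 * ξ / 4 ≤ T) (hUhi : U ≤ 5 * y / 4)
    (hl : 32 ≤ Real.log ξ) (hlogT : Real.log ξ / 2 ≤ Real.log T)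
    (hlogL1 : Real.log ξ / 2 ≤ Real.log L) (hr3 : y ^ 2 / ξ ≤ ξ ^ (3 / 10 : ℝ)) :
    U * (Real.log L - Real.log T) / (Real.log T * Real.log L) ≤ 25 / 3 * ξ ^ (3 / 10 : ℝ) := by
  have hL0 : 0 < L := by rw [hL]; linarith
  have hlogT0 : 0 < Real.log T := by linarith
  have hlogLT : Real.log L - Real.log T ≤ U / T := by
    have h := Real.log_le_sub_one_of_pos (div_pos hL0 hT0)
    rw [Real.log_div hL0.ne' hT0.ne'] at h
    have e : L / T - 1 = U / T := by rw [hL, add_div, div_self hT0.ne']; ring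
    linarith [e]
  have hnum : U * (Real.log L - Real.log T) ≤ 25 / 12 * (y ^ 2 / ξ) := by
    calc U * (Real.log L - Real.log T) ≤ U * (U / T) := mul_le_mul_of_nonneg_left hlogLT hU0.le
      _ = U ^ 2 / T := by ring
      _ ≤ (5 * y / 4) ^ 2 / (3 * ξ / 4) :=
          div_le_div₀ (by positivity) (pow_le_pow_left₀ hU0.le hUhi 2) (by positivity) hTlo
      _ = 25 / 12 * (y ^ 2 / ξ) := by
          rw [div_eq_iff (by positivity)]
          field_simp
          ring
  have hden : Real.log ξ ^ 2 / 4 ≤ Real.log T * Real.log L := by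
    calc Real.log ξ ^ 2 / 4 = Real.log ξ / 2 * (Real.log ξ / 2) := by ring
      _ ≤ Real.log T * Real.log L := mul_le_mul hlogT hlogL1 (by positivity) hlogT0.le
  have hl1 : 1 ≤ Real.log ξ ^ 2 := by nlinarith
  calc U * (Real.log L - Real.log T) / (Real.log T * Real.log L)
      ≤ 25 / 12 * (y ^ 2 / ξ) / (Real.log ξ ^ 2 / 4) :=
        div_le_div₀ (by positivity) hnum (by positivity) hden
    _ = 25 / 3 * (y ^ 2 / ξ) / Real.log ξ ^ 2 := by
        rw [div_div_eq_mul_div]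
        ring
    _ ≤ 25 / 3 * (y ^ 2 / ξ) := div_le_self (by positivity) hl1
    _ ≤ 25 / 3 * ξ ^ (3 / 10 : ℝ) := by gcongr

/-- Second `li` term at two levels:
`(U − L^b)(log U − b log L)/(log L log U) ≤ ((48K + 30)/b) ξ^{3/10}`
(`|U − L^b| ≤ 3y`, `|log U − b log L| ≤ |log(U/y)| + b|log(L/ξ)|`). [folklore] -/
private theorem li_term2_le {K ξ y T U L b : ℝ} (hK : 0 < K) (hξ1 : 1 ≤ ξ) (hy0 : 0 < y)
    (hU0 : 0 < U) (hL0 : 0 < L) (hL : L = T + U) (hb0 : 0 < b) (hb1 : b ≤ 1)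
    (hly : Real.log y = b * Real.log ξ) (hl : 32 ≤ Real.log ξ) (hUhi : U ≤ 5 * y / 4)
    (hT1 : |T - ξ| ≤ K * Real.sqrt ξ * Real.log ξ ^ 2)
    (hU1 : |U - y| ≤ K * Real.sqrt y * Real.log y ^ 2)
    (hU2 : K * Real.sqrt y * Real.log y ^ 2 ≤ y / 4) (hLb : L ^ b ≤ 3 / 2 * y)
    (hlogdiff : |Real.log L - Real.log ξ| ≤ 2 * |ξ - L| / ξ)
    (hlogU : b * Real.log ξ / 2 ≤ Real.log U) (hlogL1 : Real.log ξ / 2 ≤ Real.log L)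
    (hr1 : Real.sqrt y ≤ ξ ^ (3 / 10 : ℝ)) (hr2 : y / Real.sqrt ξ ≤ ξ ^ (3 / 10 : ℝ))
    (hr3 : y ^ 2 / ξ ≤ ξ ^ (3 / 10 : ℝ)) :
    (U - L ^ b) * (Real.log U - b * Real.log L) / (Real.log L * Real.log U) ≤
      (48 * K + 30) / b * ξ ^ (3 / 10 : ℝ) := by
  have hξ0 : 0 < ξ := by linarith
  have hl0 : 0 < Real.log ξ := by linarith
  have hlogL0 : 0 < Real.log L := by linarith
  have hlogU0 : 0 < Real.log U := lt_of_lt_of_le (by positivity) hlogU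
  have hUL : |U - L ^ b| ≤ 3 * y := by
    have := Real.rpow_nonneg hL0.le b
    rw [abs_le]; constructor <;> linarith
  have hUy : |Real.log U - Real.log y| ≤ 2 * (K * Real.sqrt y * Real.log y ^ 2) / y := by
    have hq : |U / y - 1| = |U - y| / y := by
      rw [show U / y - 1 = (U - y) / y by field_simp, abs_div, abs_of_pos hy0]
    have hq' : |U / y - 1| ≤ 1 / 2 := by
      rw [hq, div_le_iff₀ hy0]
      linarith
    have := abs_log_le_two_mul hq'
    rw [Real.log_div hU0.ne' hy0.ne', hq] at this
    calc |Real.log U - Real.log y| ≤ 2 * (|U - y| / y) := this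
      _ ≤ 2 * (K * Real.sqrt y * Real.log y ^ 2) / y := by
          rw [mul_div_assoc]
          gcongr
  have hξL : |ξ - L| ≤ K * Real.sqrt ξ * Real.log ξ ^ 2 + 5 * y / 4 := by
    have h1 := (abs_le.1 hT1).1
    have h2 := (abs_le.1 hT1).2
    rw [hL, abs_le]; constructor <;> linarith
  have hnumer : |Real.log U - b * Real.log L| ≤
      2 * (K * Real.sqrt y * Real.log y ^ 2) / y +
        2 * (K * Real.sqrt ξ * Real.log ξ ^ 2 + 5 * y / 4) / ξ := by
    have e : Real.log U - b * Real.log L =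
        (Real.log U - Real.log y) - b * (Real.log L - Real.log ξ) := by
      rw [hly]; ring
    rw [e]
    refine (abs_sub _ _).trans (add_le_add hUy ?_)
    rw [abs_mul, abs_of_pos hb0]
    calc b * |Real.log L - Real.log ξ| ≤ 1 * (2 * |ξ - L| / ξ) :=
          mul_le_mul hb1 hlogdiff (abs_nonneg _) zero_le_one
      _ ≤ 2 * (K * Real.sqrt ξ * Real.log ξ ^ 2 + 5 * y / 4) / ξ := by
          rw [one_mul]
          gcongr
  have hden2 : b * Real.log ξ ^ 2 / 4 ≤ Real.log L * Real.log U := by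
    calc b * Real.log ξ ^ 2 / 4 = Real.log ξ / 2 * (b * Real.log ξ / 2) := by ring
      _ ≤ Real.log L * Real.log U := mul_le_mul hlogL1 hlogU (by positivity) hlogL0.le
  refine (le_abs_self _).trans ?_
  rw [abs_div, abs_mul, abs_of_pos (mul_pos hlogL0 hlogU0)]
  refine (div_le_div₀ (by positivity) (mul_le_mul hUL hnumer (abs_nonneg _) (by positivity))
    (by positivity) hden2).trans ?_
  -- simplify the explicit bound
  have hly2 : Real.log y ^ 2 ≤ Real.log ξ ^ 2 := by
    rw [hly]
    have : b * Real.log ξ ≤ 1 * Real.log ξ := mul_le_mul_of_nonneg_right hb1 hl0.le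
    rw [one_mul] at this
    exact pow_le_pow_left₀ (by positivity) this 2
  have hx1 : 1 ≤ ξ ^ (3 / 10 : ℝ) := Real.one_le_rpow hξ1 (by norm_num)
  have hl1 : 1 ≤ Real.log ξ ^ 2 := by nlinarith
  have e1 : 3 * y * (2 * (K * Real.sqrt y * Real.log y ^ 2) / y +
      2 * (K * Real.sqrt ξ * Real.log ξ ^ 2 + 5 * y / 4) / ξ) =
      6 * K * (Real.sqrt y * Real.log y ^ 2) + 6 * K * Real.log ξ ^ 2 * (y * (Real.sqrt ξ / ξ))
        + 15 / 2 * (y ^ 2 / ξ) := by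
    field_simp
    ring
  have i1 : Real.sqrt y * Real.log y ^ 2 ≤ ξ ^ (3 / 10 : ℝ) * Real.log ξ ^ 2 :=
    mul_le_mul hr1 hly2 (by positivity) (by positivity)
  have i2 : y * (Real.sqrt ξ / ξ) ≤ ξ ^ (3 / 10 : ℝ) := by
    rw [Real.sqrt_div_self', mul_one_div]; exact hr2
  have hS2 : 3 * y * (2 * (K * Real.sqrt y * Real.log y ^ 2) / y +
      2 * (K * Real.sqrt ξ * Real.log ξ ^ 2 + 5 * y / 4) / ξ) ≤
      (12 * K + 15 / 2) * Real.log ξ ^ 2 * ξ ^ (3 / 10 : ℝ) := by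
    rw [e1]
    have j1 := mul_le_mul_of_nonneg_left i1 (by positivity : (0 : ℝ) ≤ 6 * K)
    have j2 := mul_le_mul_of_nonneg_left i2 (by positivity : (0 : ℝ) ≤ 6 * K * Real.log ξ ^ 2)
    have j3 : y ^ 2 / ξ ≤ ξ ^ (3 / 10 : ℝ) * Real.log ξ ^ 2 := by
      calc y ^ 2 / ξ ≤ ξ ^ (3 / 10 : ℝ) * 1 := by rw [mul_one]; exact hr3
        _ ≤ ξ ^ (3 / 10 : ℝ) * Real.log ξ ^ 2 := by gcongr
    linarith
  rw [div_le_iff₀ (by positivity : 0 < b * Real.log ξ ^ 2 / 4)]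
  refine hS2.trans (le_of_eq ?_)
  rw [div_mul_eq_mul_div, mul_div_assoc, mul_div_assoc]
  field_simp
  ring

set_option maxHeartbeats 400000 in
/-- **The `li` terms at two levels (under RH).** For large `ξ`, with `y = ξ^{β₂}`, `T = θ(ξ)`,
`U = θ(y)`, `L = T + U`:
`(li L − li T) − β₂ (li U − li L^{β₂}) − L^{β₂}/log L ≤ √ξ/log³ ξ` — `li` is concave, so the first
difference is `≤ U/log T` and the second `≥ (U − L^{β₂})/log U`, while `U ≈ y ≈ L^{β₂}` and
`log U ≈ β₂ log L`. [cite: Nicolas2022HC, §4.1 (4.2)–(4.6) (F at consecutive levels)] -/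
theorem li_levels_le_of_RH (hRH : RiemannHypothesis) : ∀ᶠ ξ : ℝ in atTop,
    (logIntegral (θ ξ + θ (ξ ^ beta 2)) - logIntegral (θ ξ))
      - beta 2 * (logIntegral (θ (ξ ^ beta 2)) -
          logIntegral ((θ ξ + θ (ξ ^ beta 2)) ^ beta 2))
      - (θ ξ + θ (ξ ^ beta 2)) ^ beta 2 / Real.log (θ ξ + θ (ξ ^ beta 2)) ≤
      Real.sqrt ξ / Real.log ξ ^ 3 := by
  obtain ⟨K, X, hK, hX1, hS⟩ := twoLevel_setup_of_RH hRH
  obtain ⟨hb0, hb34⟩ := beta_two_bounds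
  obtain ⟨hb1, hb2⟩ := beta_two_bounds'
  filter_upwards [eventually_ge_atTop X,
    eventually_mul_log_pow_le_rpow (25 / 3 + (48 * K + 30) / beta 2) 3
      (by norm_num : (0 : ℝ) < 1 / 5)] with ξ hξX hsm
  obtain ⟨hl, hy5, hT1, hT2, hU1, hU2, hlogT, hlogU, hlogL1, hlogL2⟩ := hS ξ hξX
  have hξ0 : 0 < ξ := by linarith
  have hξ1 : 1 ≤ ξ := by linarith
  have hξe : Real.exp 4 ≤ ξ :=
    (Real.exp_le_exp.2 (by norm_num : (4 : ℝ) ≤ 32)).trans ((Real.le_log_iff_exp_le hξ0).1 hl)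
  obtain ⟨hr1, hr2, hr3, hr4⟩ := rpow_beta_aux hξ1
  have hly : Real.log (ξ ^ beta 2) = beta 2 * Real.log ξ := Real.log_rpow hξ0 _
  have hy0 : 0 < ξ ^ beta 2 := Real.rpow_pos_of_pos hξ0 _
  have h32b : ((3 / 2 : ℝ)) ^ beta 2 ≤ 3 / 2 := by
    calc ((3 / 2 : ℝ)) ^ beta 2 ≤ (3 / 2 : ℝ) ^ (1 : ℝ) :=
          Real.rpow_le_rpow_of_exponent_le (by norm_num) (by linarith)
      _ = 3 / 2 := Real.rpow_one _
  have hmul : (ξ * (3 / 2)) ^ beta 2 = ξ ^ beta 2 * (3 / 2 : ℝ) ^ beta 2 :=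
    Real.mul_rpow hξ0.le (by norm_num)
  set b := beta 2 with hb
  set y := ξ ^ b with hy
  set T := θ ξ with hT
  set U := θ y with hU
  set L := T + U with hL
  have hl0 : 0 < Real.log ξ := by linarith
  -- ranges
  have hTlo : 3 * ξ / 4 ≤ T := by have := (abs_le.1 hT1).1; linarith
  have hThi : T ≤ 5 * ξ / 4 := by have := (abs_le.1 hT1).2; linarith
  have hUlo : 3 * y / 4 ≤ U := by have := (abs_le.1 hU1).1; linarith
  have hUhi : U ≤ 5 * y / 4 := by have := (abs_le.1 hU1).2; linarith
  have hT0 : 0 < T := by linarith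
  have hU0 : 0 < U := by linarith
  have hL0 : 0 < L := by linarith
  have hLlo : 3 * ξ / 4 ≤ L := by linarith
  have hLhi : L ≤ 3 * ξ / 2 := by linarith
  have hlogT0 : 0 < Real.log T := by linarith
  have hlogU0 : 0 < Real.log U := lt_of_lt_of_le (by positivity) hlogU
  have hlogL0 : 0 < Real.log L := by linarith
  have hT1' : 1 < T := by
    by_contra h
    linarith [Real.log_nonpos hT0.le (not_lt.1 h)]
  have hU1' : 1 < U := by
    by_contra h
    linarith [Real.log_nonpos hU0.le (not_lt.1 h)]
  have hL1' : 1 < L := by linarith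
  have hLb1 : 1 < L ^ b := Real.one_lt_rpow hL1' hb0
  -- (iii) upper slope of `li`
  have h3 : logIntegral L - logIntegral T ≤ U / Real.log T := by
    have := logIntegral_sub_le_sub_div_log hT1' (show T ≤ L by linarith)
    have e : L - T = U := by rw [hL]; ring
    rwa [e] at this
  -- (iv) lower slope of `li`
  have h4 : (U - L ^ b) / Real.log U ≤ logIntegral U - logIntegral (L ^ b) := by
    rcases le_total (L ^ b) U with h | h
    · exact sub_div_log_le_logIntegral_sub hLb1 h
    · have := logIntegral_sub_le_sub_div_log hU1' h
      have e : (U - L ^ b) / Real.log U = -((L ^ b - U) / Real.log U) := by ring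
      rw [e]; linarith
  -- reduce to two terms
  have hlT : Real.log T ≠ 0 := hlogT0.ne'
  have hlU : Real.log U ≠ 0 := hlogU0.ne'
  have hlL : Real.log L ≠ 0 := hlogL0.ne'
  have e : U / Real.log T - b * ((U - L ^ b) / Real.log U) - L ^ b / Real.log L =
      U * (Real.log L - Real.log T) / (Real.log T * Real.log L)
        + (U - L ^ b) * (Real.log U - b * Real.log L) / (Real.log L * Real.log U) := by
    field_simp
    ring
  have hbm := mul_le_mul_of_nonneg_left h4 hb0.le
  -- the two terms
  have hLb : L ^ b ≤ 3 / 2 * y := by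
    calc L ^ b ≤ (ξ * (3 / 2)) ^ b := Real.rpow_le_rpow hL0.le (by linarith) hb0.le
      _ = y * (3 / 2 : ℝ) ^ b := hmul
      _ ≤ y * (3 / 2) := by gcongr
      _ = 3 / 2 * y := by ring
  obtain ⟨-, -, hlogdiff, -⟩ := log_level_bounds hξe hLlo hLhi
  have ht1 := li_term1_le hξ0 hy0 hT0 hU0 hL hTlo hUhi hl hlogT hlogL1 hr3
  have ht2 := li_term2_le hK hξ1 hy0 hU0 hL0 hL hb0 (by linarith) hly hl hUhi hT1 hU1 hU2 hLb
    hlogdiff hlogU hlogL1 hr1 hr2 hr3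
  -- conclusion
  have htot : (25 / 3 + (48 * K + 30) / b) * ξ ^ (3 / 10 : ℝ) ≤ Real.sqrt ξ / Real.log ξ ^ 3 := by
    rw [le_div_iff₀ (pow_pos hl0 3)]
    calc (25 / 3 + (48 * K + 30) / b) * ξ ^ (3 / 10 : ℝ) * Real.log ξ ^ 3
        = (25 / 3 + (48 * K + 30) / b) * Real.log ξ ^ 3 * ξ ^ (3 / 10 : ℝ) := by ring
      _ ≤ ξ ^ (1 / 5 : ℝ) * ξ ^ (3 / 10 : ℝ) := by gcongr
      _ = Real.sqrt ξ := by rw [mul_comm]; exact hr4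
  have hsum : U * (Real.log L - Real.log T) / (Real.log T * Real.log L)
      + (U - L ^ b) * (Real.log U - b * Real.log L) / (Real.log L * Real.log U) ≤
      (25 / 3 + (48 * K + 30) / b) * ξ ^ (3 / 10 : ℝ) := by
    have := add_le_add ht1 ht2
    linarith
  linarith [h3, hbm, e, hsum, htot]

set_option maxHeartbeats 400000 in
/-- **Under RH, (1.9) holds at every large two-level number `N(ξ) = ξ# (ξ^{β₂})#.**
With `L = log N(ξ) = θ(ξ) + θ(ξ^{β₂})` and `log d(N(ξ))/log 2 = π(ξ) + β₂ π(ξ^{β₂})`: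
`F(L) − R(L) − π(ξ) − β₂π(ξ^{β₂}) = (A(ξ) − R(ξ)) + (R(ξ) − R(L)) + (li-terms) + β₂ A(ξ^{β₂})
 ≤ (9.2 + 1 + 1 + 1) √ξ/log³ ξ ≤ 25.3 √L/log³ L`.
[cite: Nicolas2022HC, Thm. 1.1 (iii) under RH (§4.5, first case) with Prop. 2.12 (2.53)] -/
theorem ineq19_twoLevel_eventually_of_RH (hRH : RiemannHypothesis) :
    ∀ᶠ ξ : ℝ in atTop, Ineq19 (twoLevel ξ) := by
  obtain ⟨K, X, hK, hX1, hS⟩ := twoLevel_setup_of_RH hRH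
  obtain ⟨C, Ξ, hC, hΞ, hRdiff⟩ := abs_R_sub_R_le_of_RH hRH
  filter_upwards [eventually_ge_atTop X, eventually_ge_atTop Ξ, liThetaSubPi_sub_R_le_of_RH hRH,
    beta_mul_liThetaSubPi_le_of_RH hRH, li_levels_le_of_RH hRH,
    eventually_mul_log_pow_le_rpow (C * (K + 9 / 4)) 5 (by norm_num : (0 : ℝ) < 1 / 5)]
    with ξ hξX hξΞ hAR hA2 hli hsm
  obtain ⟨hl, hy5, hT1, hT2, hU1, hU2, hlogT, hlogU, hlogL1, hlogL2⟩ := hS ξ hξX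
  have hξ0 : 0 < ξ := by linarith
  have hξ1 : 1 ≤ ξ := by linarith
  have hl0 : 0 < Real.log ξ := by linarith
  have hsξ : 0 < Real.sqrt ξ := Real.sqrt_pos.2 hξ0
  obtain ⟨-, hr2, -, hr4⟩ := rpow_beta_aux hξ1
  have hy0 : 0 < ξ ^ beta 2 := Real.rpow_pos_of_pos hξ0 _
  have hξe : Real.exp 32 ≤ ξ := (Real.le_log_iff_exp_le hξ0).1 hl
  have hTlo : 3 * ξ / 4 ≤ θ ξ := by have := (abs_le.1 hT1).1; linarith
  have hThi : θ ξ ≤ 5 * ξ / 4 := by have := (abs_le.1 hT1).2; linarith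
  have hUlo : 3 * ξ ^ beta 2 / 4 ≤ θ (ξ ^ beta 2) := by have := (abs_le.1 hU1).1; linarith
  have hUhi : θ (ξ ^ beta 2) ≤ 5 * ξ ^ beta 2 / 4 := by have := (abs_le.1 hU1).2; linarith
  have hL34 : 3 * ξ / 4 ≤ θ ξ + θ (ξ ^ beta 2) := by linarith
  have hL32 : θ ξ + θ (ξ ^ beta 2) ≤ 3 * ξ / 2 := by linarith
  -- (ii) `R(ξ) − R(L) ≤ √ξ/log³ ξ`
  have hR : R ξ - R (θ ξ + θ (ξ ^ beta 2)) ≤ Real.sqrt ξ / Real.log ξ ^ 3 := by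
    refine (le_abs_self _).trans ((hRdiff ξ _ hξΞ hL34 hL32).trans ?_)
    have hξL : |ξ - (θ ξ + θ (ξ ^ beta 2))| ≤
        K * Real.sqrt ξ * Real.log ξ ^ 2 + 5 * ξ ^ beta 2 / 4 := by
      have h1 := (abs_le.1 hT1).1
      have h2 := (abs_le.1 hT1).2
      rw [abs_le]; constructor <;> linarith
    have hy' : ξ ^ beta 2 ≤ ξ ^ (3 / 10 : ℝ) * Real.sqrt ξ := (div_le_iff₀ hsξ).1 hr2
    have hD : |ξ - (θ ξ + θ (ξ ^ beta 2))| / Real.sqrt ξ ≤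
        K * Real.log ξ ^ 2 + 5 / 4 * ξ ^ (3 / 10 : ℝ) := by
      rw [div_le_iff₀ hsξ]
      refine hξL.trans ?_
      nlinarith
    have hl1 : 1 ≤ Real.log ξ ^ 2 := by nlinarith
    have hx1 : 1 ≤ ξ ^ (3 / 10 : ℝ) := Real.one_le_rpow hξ1 (by norm_num)
    have step : |ξ - (θ ξ + θ (ξ ^ beta 2))| / Real.sqrt ξ + 1 ≤
        (K + 9 / 4) * Real.log ξ ^ 2 * ξ ^ (3 / 10 : ℝ) := by
      have j1 : 0 ≤ K * Real.log ξ ^ 2 * (ξ ^ (3 / 10 : ℝ) - 1) := by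
        have := sub_nonneg.2 hx1; positivity
      have j2 : 0 ≤ (Real.log ξ ^ 2 - 1) * ξ ^ (3 / 10 : ℝ) := by
        have := sub_nonneg.2 hl1; positivity
      have j3 : 1 ≤ Real.log ξ ^ 2 * ξ ^ (3 / 10 : ℝ) := one_le_mul_of_one_le_of_one_le hl1 hx1
      linarith
    calc C * (|ξ - (θ ξ + θ (ξ ^ beta 2))| / Real.sqrt ξ + 1)
        ≤ C * ((K + 9 / 4) * Real.log ξ ^ 2 * ξ ^ (3 / 10 : ℝ)) :=
          mul_le_mul_of_nonneg_left step hC.le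
      _ = C * (K + 9 / 4) * Real.log ξ ^ 5 * ξ ^ (3 / 10 : ℝ) / Real.log ξ ^ 3 := by
          rw [eq_div_iff (pow_pos hl0 3).ne']
          ring
      _ ≤ ξ ^ (1 / 5 : ℝ) * ξ ^ (3 / 10 : ℝ) / Real.log ξ ^ 3 := by gcongr
      _ = Real.sqrt ξ / Real.log ξ ^ 3 := by rw [mul_comm (ξ ^ (1 / 5 : ℝ)), hr4]
  -- scale comparison and the positive `L^{β₃}` term
  have hcmp := err_scale_cmp hξe hL34 hL32
  have hpos : 0 ≤ 1.45 * (θ ξ + θ (ξ ^ beta 2)) ^ beta 3 / Real.log (θ ξ + θ (ξ ^ beta 2)) := by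
    have : 0 ≤ (θ ξ + θ (ξ ^ beta 2)) ^ beta 3 := Real.rpow_nonneg (by linarith) _
    have : 0 < Real.log (θ ξ + θ (ξ ^ beta 2)) := by linarith
    positivity
  -- unfold (1.9) at `N(ξ)`
  rw [Ineq19, log_twoLevel, log2d_twoLevel hξ1, F]
  have hA1 := liThetaSubPi_def ξ
  have hA2' : beta 2 * (Nat.primeCounting ⌊ξ ^ beta 2⌋₊ : ℝ) =
      beta 2 * logIntegral (θ (ξ ^ beta 2)) - beta 2 * liThetaSubPi (ξ ^ beta 2) := by
    rw [liThetaSubPi_def]; ring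
  linarith [hAR, hA2, hli, hR, hcmp, hpos, hA1, hA2']

/-- **RH ⟹ Nicolas's Theorem 1.1 (iii), RH case**: under the Riemann Hypothesis there are
infinitely many `n` (the two-level numbers `N(ξ) = ξ# (ξ^{β₂})#`, `ξ → ∞`) with
`log d(n)/log 2 ≥ F(log n) − R(log n) − 25.3 √(log n)/log³ log n − 1.45 (log n)^{β₃}/log log n`.
This is the RH half of the tree fact `Nicolas2022_thm_1_1_iii` (which, as printed, asserts (iii)
unconditionally; its `¬RH` half is §4.5 (4.23)–(4.24) of the paper — see the module docstring).
[cite: Nicolas2022HC, Thm. 1.1 (iii)] -/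
theorem Nicolas2022_thm_1_1_iii_of_RH (hRH : RiemannHypothesis) : Nicolas2022_thm_1_1_iii :=
  thm_1_1_iii_of_eventually (ineq19_twoLevel_eventually_of_RH hRH)

end Nicolas2022

end Literature.NumberTheory.LFunctions

end
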